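import Literature.Analysis.Complex.HormanderL2Cutoff
import Literature.Analysis.Complex.WirtingerMollification
import Literature.Analysis.FluidPDE.MollifiedLimits
import HarnessLib

/-!
# Density of test forms in `D_{T*} ∩ D_S` and Hörmander's estimate on `D_{T*} ∩ F`

Layer `Literature/Analysis/Complex`; continues `HormanderL2Cutoff.lean` and `HormanderL2Estimate.lean`
(L. Hörmander, *An Introduction to Complex Analysis in Several Variables* (1973), Lemma 4.1.3, p. 79–81,
and §4.2 p. 84: «(4.2.9) holds … hence when `f ∈ D_{T*} ∩ D_S`»).

On a Riemann domain `D` with weights `W = (φ₁, φ₂, φ₃)` (`φ₁, φ₂` smooth) we prove the **graph-norm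
density of test forms** (Lemma 4.1.3): for graph data `(f, t, s)` (`HormanderL2Cutoff.GraphData`) and
every `ε > 0` there is a test form `g` with
`‖g - f‖_{φ₂} ≤ ε`, `‖ϑ g - t‖_{φ₁} ≤ ε`, `‖S g - s‖_{φ₃} ≤ ε` (`GraphData.approx`), provided a
cut-off sequence with (4.1.6) exists. The proof is Hörmander's: cut-offs (`HormanderL2Cutoff`), a
partition of unity subordinate to the flat charts, and Friedrichs mollification in each chart
(`WirtingerMollification`; the weak identities are transported by `RiemannDomainWeakDbar.…integral_target`).
As a consequence (`hormander_estimate_of_mem_F`), for the weights `φ - 2ψ, φ - ψ, φ` of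
`HormanderL2Estimate` the basic estimate passes from test forms to `D_{T*} ∩ F`:
`∫ κ |f|² e^{-φ} ≤ 2 ‖T* f‖²_{φ₁}` whenever `0 ≤ κ ≤ c - 2|∂ψ|²` (Fatou).

Everything is proved; the only definitions are the chart representative `rep`, the mollified form
`mollForm` and the bookkeeping predicate `GraphData.Approx`; no named facts.

## References

* L. Hörmander, *An Introduction to Complex Analysis in Several Variables* (1973), Lemma 4.1.3 and its
  proof, p. 79–81; §4.2, p. 84; proof of Lemma 4.4.1, p. 92. [HormanderSCV1973]

#harness_tags complex_analysis.several_variables, complex_analysis.l2_estimates, complex_geometry.riemann_existence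
-/

noncomputable section

open scoped Manifold ContDiff Topology ComplexConjugate NNReal InnerProductSpace ENNReal Convolution
open scoped LinearPMap
open Set Filter Function Complex MeasureTheory MeasureTheory.Measure ContinuousLinearMap

namespace Literature.Analysis.Complex

namespace RiemannDomain

universe u

variable {ι : Type} [Fintype ι] {D : RiemannDomain.{u} ι}

/-! ### Euclidean cut-offs -/

omit [Fintype ι] in
/-- **Smooth Euclidean cut-offs** on `ℂ^ι`: for compact `K ⊆ U` open there is a `C^∞` function
`θ : ℂ^ι → [0,1]` with compact support in `U` and `θ = 1` near `K`. [folklore] -/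
theorem exists_contDiff_cutoff_eucl [Fintype ι] {K U : Set (ι → ℂ)} (hK : IsCompact K) (hU : IsOpen U) (hKU : K ⊆ U) :
    ∃ θ : (ι → ℂ) → ℝ, ContDiff ℝ ∞ θ ∧ HasCompactSupport θ ∧ tsupport θ ⊆ U ∧
      (∀ z, θ z ∈ Icc (0 : ℝ) 1) ∧ ∀ᶠ z in 𝓝ˢ K, θ z = 1 := by
  obtain ⟨W, hWo, hKW, hWU, hWc⟩ := exists_open_between_and_isCompact_closure hK hU hKU
  obtain ⟨V, hVo, hKV, hVW, hVc⟩ := exists_open_between_and_isCompact_closure hK hWo hKW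
  obtain ⟨f, hf0, hf1, hf01⟩ := exists_contMDiffMap_zero_one_of_isClosed 𝓘(ℝ, ι → ℂ) (n := (⊤ : ℕ∞))
    hWo.isClosed_compl isClosed_closure (disjoint_compl_left_iff_subset.2 hVW)
  refine ⟨f, contMDiff_iff_contDiff.1 f.contMDiff, ?_, ?_, hf01, ?_⟩
  · refine HasCompactSupport.intro' hWc isClosed_closure fun x hx ↦ hf0 ?_
    exact fun h ↦ hx (subset_closure h)
  · refine (closure_minimal (fun x hx ↦ ?_) isClosed_closure).trans hWU
    by_contra h
    exact hx (hf0 fun h' ↦ h (subset_closure h'))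
  · exact eventually_of_mem (hVo.mem_nhdsSet.2 hKV) fun x hx ↦ hf1 (subset_closure hx)

/-! ### Chart representatives -/

section Rep

variable {e : OpenPartialHomeomorph D (ι → ℂ)}

variable (e) in
/-- The **chart representative** of `u : D → ℂ` along a flat chart `e`: `u ∘ e⁻¹` on `e.target`,
extended by `0`. [folklore] -/
def rep (u : D → ℂ) : (ι → ℂ) → ℂ := e.target.indicator (u ∘ e.symm)

/-- The representative on the target. [folklore] -/
theorem rep_apply_of_mem {u : D → ℂ} {z : ι → ℂ} (hz : z ∈ e.target) : rep e u z = u (e.symm z) := by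
  rw [rep, indicator_of_mem hz]; rfl

/-- The representative off the target. [folklore] -/
theorem rep_apply_of_notMem {u : D → ℂ} {z : ι → ℂ} (hz : z ∉ e.target) : rep e u z = 0 := by
  rw [rep, indicator_of_notMem hz]

/-- `rep` is additive. [folklore] -/
theorem rep_add (u v : D → ℂ) : rep e (fun x ↦ u x + v x) = fun z ↦ rep e u z + rep e v z := by
  funext z
  by_cases hz : z ∈ e.target
  · simp only [rep_apply_of_mem hz]
  · simp only [rep_apply_of_notMem hz, add_zero]

/-- `rep` is subtractive. [folklore] -/
theorem rep_sub (u v : D → ℂ) : rep e (fun x ↦ u x - v x) = fun z ↦ rep e u z - rep e v z := by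
  funext z
  by_cases hz : z ∈ e.target
  · simp only [rep_apply_of_mem hz]
  · simp only [rep_apply_of_notMem hz, sub_zero]

/-- `rep` commutes with multiplication by a function of the chart coordinate. [folklore] -/
theorem rep_mul (u v : D → ℂ) : rep e (fun x ↦ u x * v x) = fun z ↦ rep e u z * rep e v z := by
  funext z
  by_cases hz : z ∈ e.target
  · simp only [rep_apply_of_mem hz]
  · simp only [rep_apply_of_notMem hz, mul_zero]

/-- The representative of a function vanishing off `K` vanishes off `e(K)`. [folklore] -/
theorem rep_eq_zero_of_notMem_image {u : D → ℂ} {K : Set D} (hu : ∀ x ∉ K, u x = 0) {z : ι → ℂ}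
    (hz : z ∉ e '' K) : rep e u z = 0 := by
  by_cases hzt : z ∈ e.target
  · rw [rep_apply_of_mem hzt]
    refine hu _ fun hK ↦ hz ⟨e.symm z, hK, e.right_inv hzt⟩
  · exact rep_apply_of_notMem hzt

/-- Support of the representative. [folklore] -/
theorem support_rep_subset {u : D → ℂ} {K : Set D} (hu : ∀ x ∉ K, u x = 0) : support (rep e u) ⊆ e '' K :=
  fun _ hz ↦ by_contra fun h ↦ hz (rep_eq_zero_of_notMem_image hu h)

/-- The image of a compact subset of `e.source` is compact and lies in `e.target`. [folklore] -/
theorem isCompact_image {K : Set D} (hK : IsCompact K) (hKe : K ⊆ e.source) : IsCompact (e '' K) ∧ e '' K ⊆ e.target :=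
  ⟨hK.image_of_continuousOn (e.continuousOn.mono hKe), fun _ ⟨_, hx, hxz⟩ ↦ hxz ▸ e.map_source (hKe hx)⟩

/-- The representative of a function supported in a compact subset of `e.source` has compact support.
[folklore] -/
theorem hasCompactSupport_rep {u : D → ℂ} {K : Set D} (hK : IsCompact K) (hKe : K ⊆ e.source)
    (hu : ∀ x ∉ K, u x = 0) : HasCompactSupport (rep e u) :=
  HasCompactSupport.intro' (isCompact_image hK hKe).1 ((isCompact_image hK hKe).1.isClosed)
    fun _ hz ↦ rep_eq_zero_of_notMem_image hu hz

/-- AE-strong measurability of the representative. [folklore] -/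
theorem aestronglyMeasurable_rep (he : ⇑e = D.proj) {u : D → ℂ} (hu : AEStronglyMeasurable u D.vol) :
    AEStronglyMeasurable (rep e u) volume :=
  (aestronglyMeasurable_indicator_iff e.open_target.measurableSet).2 (aestronglyMeasurable_comp_symm he hu.restrict)

/-- Whole-space integrals of `rep u · V` are integrals over the target. [folklore] -/
theorem integral_rep_mul (u : D → ℂ) (V : (ι → ℂ) → ℂ) :
    ∫ z, rep e u z * V z = ∫ z in e.target, u (e.symm z) * V z := by
  rw [← integral_indicator e.open_target.measurableSet]
  refine integral_congr_ae (ae_of_all _ fun z ↦ ?_)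
  change rep e u z * V z = e.target.indicator (fun z ↦ u (e.symm z) * V z) z
  by_cases hz : z ∈ e.target
  · rw [rep_apply_of_mem hz, indicator_of_mem hz]
  · rw [rep_apply_of_notMem hz, indicator_of_notMem hz, zero_mul]

/-- **`L²`-norms along a chart (lintegral form)**: for `Φ` vanishing off `e.source`,
`∫⁻ ‖Φ‖ₑ² d vol = ∫⁻ ‖rep Φ‖ₑ² dλ`. [folklore] -/
theorem lintegral_enorm_sq_eq_rep (he : ⇑e = D.proj) {Φ : D → ℂ} (hΦm : AEStronglyMeasurable Φ D.vol)
    (hΦ0 : ∀ x ∉ e.source, Φ x = 0) :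
    ∫⁻ x, ‖Φ x‖ₑ ^ 2 ∂D.vol = ∫⁻ z, ‖rep e Φ z‖ₑ ^ 2 ∂volume := by
  have h1 : ∫⁻ x, ‖Φ x‖ₑ ^ 2 ∂D.vol = ∫⁻ x in e.source, ‖Φ x‖ₑ ^ 2 ∂D.vol := by
    rw [← lintegral_indicator e.open_source.measurableSet]
    refine lintegral_congr fun x ↦ ?_
    by_cases hx : x ∈ e.source
    · rw [indicator_of_mem hx]
    · rw [indicator_of_notMem hx, hΦ0 x hx]; simp
  have h2 : ∫⁻ z, ‖rep e Φ z‖ₑ ^ 2 ∂volume = ∫⁻ z in e.target, ‖Φ (e.symm z)‖ₑ ^ 2 ∂volume := by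
    rw [← lintegral_indicator e.open_target.measurableSet]
    refine lintegral_congr fun z ↦ ?_
    by_cases hz : z ∈ e.target
    · rw [indicator_of_mem hz, rep_apply_of_mem hz]
    · rw [indicator_of_notMem hz, rep_apply_of_notMem hz]; simp
  rw [h1, h2, ← map_symm_volume_restrict he]
  have hmeas : AEMeasurable e.symm (volume.restrict e.target) :=
    e.continuousOn_symm.aemeasurable e.open_target.measurableSet
  have hf : AEMeasurable (fun x ↦ ‖Φ x‖ₑ ^ 2) ((volume.restrict e.target).map e.symm) := by
    have : AEStronglyMeasurable Φ (D.vol.restrict e.source) := hΦm.restrict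
    rw [← map_symm_volume_restrict he] at this
    exact (ENNReal.continuous_pow 2).measurable.comp_aemeasurable this.enorm
  rw [lintegral_map' hf hmeas]

/-- Bound for a continuous function on a compact set. [folklore] -/
theorem exists_forall_le_of_isCompact {K : Set D} (hK : IsCompact K) {g : D → ℝ} (hg : Continuous g) :
    ∃ M, 0 < M ∧ ∀ x ∈ K, g x ≤ M := by
  obtain ⟨M, hM⟩ := (hK.bddAbove_image hg.continuousOn)
  refine ⟨max M 1, lt_max_of_lt_right one_pos, fun x hx ↦ (hM ⟨x, hx, rfl⟩).trans (le_max_left _ _)⟩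

/-- **Weighted vs. flat `L²` on a compact set, I**: `∫⁻ ‖Φ‖ₑ² e^{-φ} d vol ≤ M ∫⁻ ‖Φ‖ₑ² d vol` when
`e^{-φ} ≤ M` on the support. [folklore] -/
theorem lintegral_volW_le {φ : D → ℝ} (hφ : Continuous φ) {K : Set D} {M : ℝ} (hM : ∀ x ∈ K, Real.exp (-φ x) ≤ M)
    {Φ : D → ℂ} (hΦ0 : ∀ x ∉ K, Φ x = 0) :
    ∫⁻ x, ‖Φ x‖ₑ ^ 2 ∂D.volW φ ≤ ENNReal.ofReal M * ∫⁻ x, ‖Φ x‖ₑ ^ 2 ∂D.vol := by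
  rw [volW, lintegral_withDensity_eq_lintegral_mul_non_measurable _ (measurable_coe_weight hφ)
    (Eventually.of_forall fun x ↦ ENNReal.coe_lt_top), ← lintegral_const_mul' _ _ ENNReal.ofReal_ne_top]
  refine lintegral_mono fun x ↦ ?_
  by_cases hx : x ∈ K
  · simp only [Pi.mul_apply]
    gcongr
    rw [← ENNReal.ofReal_coe_nnreal, coe_weight]
    exact ENNReal.ofReal_le_ofReal (hM x hx)
  · simp [hΦ0 x hx]

/-- **Weighted `L²` on `D` vs. flat `L²` in the chart**: if `Φ` vanishes off a compact
`K ⊆ e.source` on which `e^{-φ} ≤ M`, then `‖Φ‖_{L²(e^{-φ} vol)} ≤ M^{1/2} ‖rep Φ‖_{L²(λ)}`.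
[folklore] -/
theorem eLpNorm_volW_le_rep (he : ⇑e = D.proj) {φ : D → ℝ} (hφ : Continuous φ) {K : Set D}
    (hKe : K ⊆ e.source) {M : ℝ} (hM : ∀ x ∈ K, Real.exp (-φ x) ≤ M)
    {Φ : D → ℂ} (hΦm : AEStronglyMeasurable Φ D.vol) (hΦ0 : ∀ x ∉ K, Φ x = 0) :
    eLpNorm Φ 2 (D.volW φ) ≤ ENNReal.ofReal M ^ (1 / 2 : ℝ) * eLpNorm (rep e Φ) 2 volume := by
  rw [FluidPDE.eLpNorm_two_eq_rpow, FluidPDE.eLpNorm_two_eq_rpow,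
    ← lintegral_enorm_sq_eq_rep he hΦm (fun x hx ↦ hΦ0 x fun h ↦ hx (hKe h)),
    ← ENNReal.mul_rpow_of_nonneg _ _ (by norm_num)]
  exact ENNReal.rpow_le_rpow (lintegral_volW_le hφ hM hΦ0) (by norm_num)

/-- **Weighted vs. flat `L²` on a compact set, II**: `∫⁻ ‖Φ‖ₑ² d vol ≤ M' ∫⁻ ‖Φ‖ₑ² e^{-φ} d vol`
when `e^{φ} ≤ M'` on the support. [folklore] -/
theorem lintegral_vol_le_volW {φ : D → ℝ} (hφ : Continuous φ) {K : Set D} {M' : ℝ}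
    (hM' : ∀ x ∈ K, Real.exp (φ x) ≤ M') {Φ : D → ℂ} (hΦ0 : ∀ x ∉ K, Φ x = 0) :
    ∫⁻ x, ‖Φ x‖ₑ ^ 2 ∂D.vol ≤ ENNReal.ofReal M' * ∫⁻ x, ‖Φ x‖ₑ ^ 2 ∂D.volW φ := by
  rw [volW, lintegral_withDensity_eq_lintegral_mul_non_measurable _ (measurable_coe_weight hφ)
    (Eventually.of_forall fun x ↦ ENNReal.coe_lt_top), ← lintegral_const_mul' _ _ ENNReal.ofReal_ne_top]
  refine lintegral_mono fun x ↦ ?_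
  by_cases hx : x ∈ K
  · have h1 : (1 : ℝ≥0∞) ≤ ENNReal.ofReal M' * (D.weight φ x : ℝ≥0∞) := by
      rw [← ENNReal.ofReal_coe_nnreal, coe_weight,
        ← ENNReal.ofReal_mul ((Real.exp_pos _).le.trans (hM' x hx)), ← ENNReal.ofReal_one]
      refine ENNReal.ofReal_le_ofReal ?_
      calc (1 : ℝ) = Real.exp (φ x) * Real.exp (-φ x) := by rw [← Real.exp_add, add_neg_cancel, Real.exp_zero]
        _ ≤ M' * Real.exp (-φ x) := mul_le_mul_of_nonneg_right (hM' x hx) (Real.exp_pos _).le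
    calc ‖Φ x‖ₑ ^ 2 = 1 * ‖Φ x‖ₑ ^ 2 := (one_mul _).symm
      _ ≤ (ENNReal.ofReal M' * (D.weight φ x : ℝ≥0∞)) * ‖Φ x‖ₑ ^ 2 := mul_le_mul_left h1 _
      _ = _ := by simp only [Pi.mul_apply]; ring
  · simp [hΦ0 x hx]

/-- **The representative of a compactly supported weighted-`L²` function is in `L²(λ)`.**
[folklore] -/
theorem memLp_rep (he : ⇑e = D.proj) {φ : D → ℝ} (hφ : Continuous φ) {K : Set D} (hK : IsCompact K)
    (hKe : K ⊆ e.source) {u : D → ℂ} (hu0 : ∀ x ∉ K, u x = 0) (hu : MemLp u 2 (D.volW φ)) :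
    MemLp (rep e u) 2 volume := by
  obtain ⟨M', -, hM'⟩ := exists_forall_le_of_isCompact hK (Real.continuous_exp.comp hφ)
  have hum : AEStronglyMeasurable u D.vol := aestronglyMeasurable_of_memLp_volW hφ hu
  refine ⟨aestronglyMeasurable_rep he hum, ?_⟩
  rw [FluidPDE.eLpNorm_two_eq_rpow, ← lintegral_enorm_sq_eq_rep he hum (fun x hx ↦ hu0 x fun h ↦ hx (hKe h))]
  refine ENNReal.rpow_lt_top_of_nonneg (by norm_num) ?_
  refine (lt_of_le_of_lt (lintegral_vol_le_volW hφ hM' hu0) (ENNReal.mul_lt_top ENNReal.ofReal_lt_top ?_)).ne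
  have := lintegral_rpow_enorm_lt_top_of_eLpNorm_lt_top two_ne_zero ENNReal.ofNat_ne_top hu.eLpNorm_lt_top
  rw [ENNReal.toReal_ofNat] at this
  simpa only [ENNReal.rpow_two] using this

/-- A weighted-`L²` function supported in a compact set is locally integrable for `vol`, and its
representative is locally integrable. [folklore] -/
theorem locallyIntegrable_rep (he : ⇑e = D.proj) {φ : D → ℝ} (hφ : Continuous φ) {K : Set D} (hK : IsCompact K)
    (hKe : K ⊆ e.source) {u : D → ℂ} (hu0 : ∀ x ∉ K, u x = 0) (hu : MemLp u 2 (D.volW φ)) :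
    LocallyIntegrable (rep e u) volume :=
  (memLp_rep he hφ hK hKe hu0 hu).locallyIntegrable one_le_two

/-- **A bounded chart multiplier**: for a function `m` continuous on `D` and a compact `K₁ ⊆ e.target`
there is `C` with `‖rep m · Ψ‖_{L²(λ)} ≤ C ‖Ψ‖_{L²(λ)}` for every `Ψ` vanishing off `K₁` (`C` bounds
`|m ∘ e⁻¹|` on `K₁`). [folklore] -/
theorem exists_eLpNorm_rep_mul_le {m : D → ℂ} (hm : Continuous m) {K₁ : Set (ι → ℂ)} (hK₁ : IsCompact K₁)
    (hK₁e : K₁ ⊆ e.target) :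
    ∃ C : ℝ, 0 < C ∧ ∀ Ψ : (ι → ℂ) → ℂ, (∀ z ∉ K₁, Ψ z = 0) →
      eLpNorm (fun z ↦ rep e m z * Ψ z) 2 volume ≤ ENNReal.ofReal C * eLpNorm Ψ 2 volume := by
  have hc : ContinuousOn (fun z ↦ ‖m (e.symm z)‖) K₁ :=
    (continuous_norm.comp_continuousOn (hm.comp_continuousOn (e.continuousOn_symm.mono hK₁e)))
  obtain ⟨C, hC⟩ := hK₁.bddAbove_image hc
  refine ⟨max C 1, lt_max_of_lt_right one_pos, fun Ψ hΨ0 ↦ eLpNorm_le_mul_eLpNorm_of_ae_le_mul (ae_of_all _ fun z ↦ ?_) 2⟩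
  by_cases hz : z ∈ K₁
  · rw [norm_mul, rep_apply_of_mem (hK₁e hz)]
    exact mul_le_mul_of_nonneg_right ((hC ⟨z, hz, rfl⟩).trans (le_max_left _ _)) (norm_nonneg _)
  · simp [hΨ0 z hz]

end Rep

/-! ### Euclidean `∂_v`: locality, continuity, support -/

section DelAlong

variable {E' : Type*} [NormedAddCommGroup E'] [NormedSpace ℂ E']

omit [Fintype ι] in
/-- `∂_v u` is continuous for `u ∈ C¹`. [folklore] -/
theorem continuous_delAlong {u : E' → ℂ} (hu : ContDiff ℝ 1 u) (v : E') : Continuous (delAlong v u) := by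
  have h := hu.continuous_fderiv one_ne_zero
  unfold delAlong
  exact (continuous_const (y := (2 : ℂ)⁻¹)).smul ((h.clm_apply continuous_const).sub
    ((continuous_const (y := I)).smul (h.clm_apply continuous_const)))

omit [Fintype ι] in
/-- `∂_v u` has compact support if `u` has. [folklore] -/
theorem hasCompactSupport_delAlong {u : E' → ℂ} (hu : HasCompactSupport u) (v : E') : HasCompactSupport (delAlong v u) := by
  refine (hu.fderiv (𝕜 := ℝ)).mono fun x hx ↦ ?_
  contrapose! hx
  simp only [mem_support, ne_eq, not_not] at hx
  simp [delAlong_apply, hx]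

omit [Fintype ι] in
/-- `∂̄_v u` vanishes off the topological support of `u`. [folklore] -/
theorem dbarAlong_eq_zero_of_notMem_tsupport' {u : E' → ℂ} {z : E'} (hz : z ∉ tsupport u) (v : E') :
    dbarAlong v u z = 0 := by
  have h : fderiv ℝ u z = 0 := by
    by_contra hne
    exact hz (support_fderiv_subset ℝ (mem_support.2 hne))
  simp [dbarAlong_apply, h]

omit [Fintype ι] in
/-- `∂_v u` vanishes off the topological support of `u`. [folklore] -/
theorem delAlong_eq_zero_of_notMem_tsupport {u : E' → ℂ} {z : E'} (hz : z ∉ tsupport u) (v : E') :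
    delAlong v u z = 0 := by
  have h : fderiv ℝ u z = 0 := by
    by_contra hne
    exact hz (support_fderiv_subset ℝ (mem_support.2 hne))
  simp [delAlong_apply, h]

end DelAlong

/-! ### The chart data of graph data supported in one chart -/

namespace Weights

variable [DecidableEq ι] {W : Weights D}

omit [DecidableEq ι] in
/-- `∂_v e^{φ} = (∂_v φ) e^{φ}` for `φ` smooth (flat derivatives on `D`). [folklore] -/
theorem del_exp_pos {φ : D → ℝ} (hφ : ContMDiff 𝓘(ℝ, ι → ℂ) 𝓘(ℝ, ℝ) ∞ φ) (v : ι → ℂ) (x : D) :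
    del v (fun y ↦ (Real.exp (φ y) : ℂ)) x = del v (fun y ↦ (φ y : ℂ)) x * (Real.exp (φ x) : ℂ) := by
  have h := del_exp_neg hφ.neg v x
  simp only [neg_neg] at h
  rw [h]
  have hneg : (fun y ↦ (((-φ y : ℝ)) : ℂ)) = (-1 : ℂ) • fun y ↦ (φ y : ℂ) := by
    funext y; simp
  have hd : DifferentiableAt ℝ ((fun y ↦ (φ y : ℂ)) ∘ (D.chart x).symm) (D.proj x) :=
    differentiableAt_comp_symm_of_contMDiff (contMDiff_ofReal hφ) x
  rw [hneg, del_const_smul hd]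
  simp

variable (W) in
/-- **The divergence datum** `h₀ = -t e^{φ₂-φ₁} + ∑_j f_j ∂_j φ₂` of graph data `(f, t, ·)`: the weak
`∑_j ∂_j f_j` (from `∑_j ∂_j (e^{-φ₂} f_j) = -e^{-φ₁} t`). [cite: HormanderSCV1973, §4.1 (4.1.9)] -/
def divDatum (f : ι → D → ℂ) (t : D → ℂ) (x : D) : ℂ :=
  -t x * (Real.exp (W.φ₂ x - W.φ₁ x) : ℂ) + ∑ j, f j x * del (Pi.single j 1) (fun y ↦ (W.φ₂ y : ℂ)) x

namespace GraphData

variable {f : ι → D → ℂ} {t : D → ℂ} {s : ι → ι → D → ℂ}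

/-- **`∑_j ∂_j f_j = h₀` weakly** for graph data, `φ₂` smooth. [cite: HormanderSCV1973, §4.1 (4.1.9)] -/
theorem hasWeakDelDiv_divDatum (h : W.GraphData f t s) (h₂ : ContMDiff 𝓘(ℝ, ι → ℂ) 𝓘(ℝ, ℝ) ∞ W.φ₂) :
    HasWeakDelDiv D (fun x j ↦ f j x) (W.divDatum f t) := by
  have hE : ContMDiff 𝓘(ℝ, ι → ℂ) 𝓘(ℝ, ℂ) ∞ fun x ↦ (Real.exp (W.φ₂ x) : ℂ) := contMDiff_ofReal (contMDiff_exp h₂)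
  refine (h.weakT.smul hE).congr_ae (fun j ↦ ae_of_all _ fun x ↦ ?_) (ae_of_all _ fun x ↦ ?_)
  · change (Real.exp (W.φ₂ x) : ℂ) * (f j x * (Real.exp (-W.φ₂ x) : ℂ)) = f j x
    rw [mul_left_comm, ← ofReal_mul, ← Real.exp_add, add_neg_cancel, Real.exp_zero, ofReal_one, mul_one]
  · change (Real.exp (W.φ₂ x) : ℂ) * (-t x * (Real.exp (-W.φ₁ x) : ℂ)) +
      ∑ j, del (Pi.single j 1) (fun y ↦ (Real.exp (W.φ₂ y) : ℂ)) x * (f j x * (Real.exp (-W.φ₂ x) : ℂ)) = W.divDatum f t x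
    rw [divDatum]
    have h1 : (Real.exp (W.φ₂ x) : ℂ) * (Real.exp (-W.φ₁ x) : ℂ) = (Real.exp (W.φ₂ x - W.φ₁ x) : ℂ) := by
      rw [← ofReal_mul, ← Real.exp_add]; ring_nf
    have h2 : (Real.exp (W.φ₂ x) : ℂ) * (Real.exp (-W.φ₂ x) : ℂ) = 1 := by
      rw [← ofReal_mul, ← Real.exp_add, add_neg_cancel, Real.exp_zero, ofReal_one]
    congr 1
    · linear_combination (-t x) * h1
    · refine Finset.sum_congr rfl fun j _ ↦ ?_
      rw [del_exp_pos h₂]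
      linear_combination (del (Pi.single j 1) (fun y ↦ (W.φ₂ y : ℂ)) x * f j x) * h2

/-- The divergence datum vanishes where `f` and `t` vanish. [folklore] -/
theorem divDatum_eq_zero {K : Set D} (hf0 : ∀ j x, x ∉ K → f j x = 0) (ht0 : ∀ x ∉ K, t x = 0) {x : D} (hx : x ∉ K) :
    W.divDatum f t x = 0 := by
  rw [divDatum, ht0 x hx, Finset.sum_eq_zero fun j _ ↦ by rw [hf0 j x hx, zero_mul]]
  ring

/-- The divergence datum lies in `L²(φ₁)` when `(f, t, s)` is graph data supported in a compact set
(the multipliers are continuous). [folklore] -/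
theorem memLp_divDatum (h : W.GraphData f t s) (h₂ : ContMDiff 𝓘(ℝ, ι → ℂ) 𝓘(ℝ, ℝ) ∞ W.φ₂) {K : Set D} (hK : IsCompact K)
    (hf0 : ∀ j x, x ∉ K → f j x = 0) (ht0 : ∀ x ∉ K, t x = 0) : MemLp (W.divDatum f t) 2 W.μ₁ := by
  -- a cut-off equal to one on `K` turns the continuous multipliers into compactly supported ones
  obtain ⟨θ, hθs, hθc, hθ01, hθ1⟩ := exists_cutoff_eq_one hK
  have hθ1' : ∀ x ∈ K, θ x = 1 := fun x hx ↦ (hθ1.self_of_nhdsSet) x hx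
  have hEc : Continuous fun x ↦ (θ x : ℂ) * (Real.exp (W.φ₂ x - W.φ₁ x) : ℂ) :=
    (continuous_ofReal.comp hθs.continuous).mul (continuous_ofReal.comp (Real.continuous_exp.comp (W.continuous₂.sub W.continuous₁)))
  have hEcs : HasCompactSupport fun x ↦ (θ x : ℂ) * (Real.exp (W.φ₂ x - W.φ₁ x) : ℂ) :=
    (hθc.comp_left ofReal_zero).mul_right
  have h1 : MemLp (fun x ↦ ((θ x : ℂ) * (Real.exp (W.φ₂ x - W.φ₁ x) : ℂ)) * t x) 2 W.μ₁ :=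
    memLp_two_volW_mul_of_hasCompactSupport W.continuous₁ W.continuous₁ hEc hEcs h.memLp_t
  have hDc : ∀ j, Continuous fun x ↦ (θ x : ℂ) * del (Pi.single j 1) (fun y ↦ (W.φ₂ y : ℂ)) x := fun j ↦
    (continuous_ofReal.comp hθs.continuous).mul (contMDiff_del (contMDiff_ofReal h₂) _).continuous
  have hDcs : ∀ j, HasCompactSupport fun x ↦ (θ x : ℂ) * del (Pi.single j 1) (fun y ↦ (W.φ₂ y : ℂ)) x := fun j ↦
    (hθc.comp_left ofReal_zero).mul_right
  have h2 : ∀ j, MemLp (fun x ↦ ((θ x : ℂ) * del (Pi.single j 1) (fun y ↦ (W.φ₂ y : ℂ)) x) * f j x) 2 W.μ₁ := fun j ↦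
    memLp_two_volW_mul_of_hasCompactSupport W.continuous₁ W.continuous₂ (hDc j) (hDcs j) (h.memLp_f j)
  refine ((h1.neg.add (memLp_finsetSum Finset.univ fun j _ ↦ h2 j))).ae_eq (ae_of_all _ fun x ↦ ?_)
  change -((θ x : ℂ) * (Real.exp (W.φ₂ x - W.φ₁ x) : ℂ) * t x) +
    ∑ j, (θ x : ℂ) * del (Pi.single j 1) (fun y ↦ (W.φ₂ y : ℂ)) x * f j x = W.divDatum f t x
  by_cases hx : x ∈ K
  · rw [hθ1' x hx, divDatum]; push_cast
    simp only [one_mul]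
    congr 1
    · ring
    · exact Finset.sum_congr rfl fun j _ ↦ mul_comm _ _
  · rw [divDatum_eq_zero hf0 ht0 hx, ht0 x hx, Finset.sum_eq_zero fun j _ ↦ by rw [hf0 j x hx, mul_zero]]
    ring

/-! #### Euclidean weak identities of the chart representatives (globalised by a cut-off) -/

variable {e : OpenPartialHomeomorph D (ι → ℂ)} {K : Set D}

/-- **The `S`-relation in the chart**, for ALL Euclidean test functions: if `(f, t, s)` is graph data
with `f` and `s` supported in a compact `K ⊆ e.source`, then
`∫ (F_k ∂̄_j Wt - F_j ∂̄_k Wt) dλ = -∫ S_{jk} Wt dλ` for the representatives `F = rep f`, `S = rep s`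
and every `Wt ∈ C_c^∞(ℂ^ι)`. [cite: HormanderSCV1973, Lemma 4.1.3 (proof, p. 80)] -/
theorem weakS_rep (h : W.GraphData f t s) (he : ⇑e = D.proj) (hK : IsCompact K) (hKe : K ⊆ e.source)
    (hf0 : ∀ j x, x ∉ K → f j x = 0) (hs0 : ∀ j k x, x ∉ K → s j k x = 0) (j k : ι)
    {Wt : (ι → ℂ) → ℂ} (hWt : ContDiff ℝ ∞ Wt) (hWtc : HasCompactSupport Wt) :
    ∫ z, (rep e (f k) z * dbarAlong (Pi.single j 1) Wt z - rep e (f j) z * dbarAlong (Pi.single k 1) Wt z) =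
      -∫ z, rep e (s j k) z * Wt z := by
  obtain ⟨hK'c, hK'e⟩ := isCompact_image (e := e) hK hKe
  obtain ⟨θ, hθs, hθc, hθe, -, hθ1⟩ := exists_contDiff_cutoff_eucl hK'c e.open_target hK'e
  -- the localised test function
  set Wt' : (ι → ℂ) → ℂ := fun z ↦ (θ z : ℂ) * Wt z with hWt'
  have hWt's : ContDiff ℝ ∞ Wt' := (ofRealCLM.contDiff.comp hθs).mul hWt
  have hWt'c : HasCompactSupport Wt' := hWtc.mul_left
  have hWt'e : tsupport Wt' ⊆ e.target :=
    (tsupport_mul_subset_left (f := fun z ↦ (θ z : ℂ)) (g := Wt)).trans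
      ((tsupport_comp_subset ofReal_zero θ).trans hθe)
  have key := h.weakS.integral_target he hWt's hWt'c hWt'e j k
  have key' : ∫ z in e.target, (f k (e.symm z) * dbarAlong (Pi.single j 1) Wt' z -
      f j (e.symm z) * dbarAlong (Pi.single k 1) Wt' z) = -∫ z in e.target, s j k (e.symm z) * Wt' z := by
    simpa only using key
  -- near `e(K)` the two test functions agree
  have hloc : ∀ z, z ∈ e '' K → Wt' =ᶠ[𝓝 z] Wt := fun z hzK ↦ by
    filter_upwards [hθ1.filter_mono (nhds_le_nhdsSet hzK)] with y hy
    simp only [hWt', hy, ofReal_one, one_mul]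
  have hF : ∀ (i : ι) (v : ι → ℂ) (z : ι → ℂ), z ∈ e.target →
      f i (e.symm z) * dbarAlong v Wt' z = f i (e.symm z) * dbarAlong v Wt z := fun i v z hz ↦ by
    by_cases hxK : e.symm z ∈ K
    · rw [dbarAlong_congr_of_eventuallyEq (hloc z ⟨e.symm z, hxK, e.right_inv hz⟩) v]
    · rw [hf0 i _ hxK, zero_mul, zero_mul]
  have hS : ∀ z ∈ e.target, s j k (e.symm z) * Wt' z = s j k (e.symm z) * Wt z := fun z hz ↦ by
    by_cases hxK : e.symm z ∈ K
    · rw [(hloc z ⟨e.symm z, hxK, e.right_inv hz⟩).self_of_nhds]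
    · rw [hs0 j k _ hxK, zero_mul, zero_mul]
  -- both sides as integrals over the target
  have hL : ∫ z, (rep e (f k) z * dbarAlong (Pi.single j 1) Wt z - rep e (f j) z * dbarAlong (Pi.single k 1) Wt z) =
      ∫ z in e.target, (f k (e.symm z) * dbarAlong (Pi.single j 1) Wt' z - f j (e.symm z) * dbarAlong (Pi.single k 1) Wt' z) := by
    rw [← integral_indicator e.open_target.measurableSet]
    refine integral_congr_ae (ae_of_all _ fun z ↦ ?_)
    change rep e (f k) z * dbarAlong (Pi.single j 1) Wt z - rep e (f j) z * dbarAlong (Pi.single k 1) Wt z =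
      e.target.indicator (fun z ↦ f k (e.symm z) * dbarAlong (Pi.single j 1) Wt' z -
        f j (e.symm z) * dbarAlong (Pi.single k 1) Wt' z) z
    by_cases hz : z ∈ e.target
    · rw [indicator_of_mem hz, rep_apply_of_mem hz, rep_apply_of_mem hz, hF k _ z hz, hF j _ z hz]
    · rw [indicator_of_notMem hz, rep_apply_of_notMem hz, rep_apply_of_notMem hz]; ring
  have hR : ∫ z, rep e (s j k) z * Wt z = ∫ z in e.target, s j k (e.symm z) * Wt' z := by
    rw [integral_rep_mul]
    exact setIntegral_congr_fun e.open_target.measurableSet fun z hz ↦ (hS z hz).symm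
  rw [hL, hR, key']

/-- **The `T*`-relation in the chart**, for ALL Euclidean test functions: with the divergence datum
`h₀` (`divDatum`), `∫ ∑_j F_j ∂_j Wt dλ = -∫ H₀ Wt dλ` for the representatives, when `f` and `t` are
supported in a compact `K ⊆ e.source` and `φ₂` is smooth. [cite: HormanderSCV1973, Lemma 4.1.3 (proof, p. 80)] -/
theorem weakT_rep (h : W.GraphData f t s) (h₂ : ContMDiff 𝓘(ℝ, ι → ℂ) 𝓘(ℝ, ℝ) ∞ W.φ₂) (he : ⇑e = D.proj)
    (hK : IsCompact K) (hKe : K ⊆ e.source) (hf0 : ∀ j x, x ∉ K → f j x = 0) (ht0 : ∀ x ∉ K, t x = 0)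
    {Wt : (ι → ℂ) → ℂ} (hWt : ContDiff ℝ ∞ Wt) (hWtc : HasCompactSupport Wt) :
    ∫ z, ∑ j, rep e (f j) z * delAlong (Pi.single j 1) Wt z = -∫ z, rep e (W.divDatum f t) z * Wt z := by
  obtain ⟨hK'c, hK'e⟩ := isCompact_image (e := e) hK hKe
  obtain ⟨θ, hθs, hθc, hθe, -, hθ1⟩ := exists_contDiff_cutoff_eucl hK'c e.open_target hK'e
  set Wt' : (ι → ℂ) → ℂ := fun z ↦ (θ z : ℂ) * Wt z with hWt'
  have hWt's : ContDiff ℝ ∞ Wt' := (ofRealCLM.contDiff.comp hθs).mul hWt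
  have hWt'c : HasCompactSupport Wt' := hWtc.mul_left
  have hWt'e : tsupport Wt' ⊆ e.target :=
    (tsupport_mul_subset_left (f := fun z ↦ (θ z : ℂ)) (g := Wt)).trans
      ((tsupport_comp_subset ofReal_zero θ).trans hθe)
  have key := (h.hasWeakDelDiv_divDatum h₂).integral_target he hWt's hWt'c hWt'e
  have key' : ∫ z in e.target, ∑ j, f j (e.symm z) * delAlong (Pi.single j 1) Wt' z =
      -∫ z in e.target, W.divDatum f t (e.symm z) * Wt' z := by
    simpa only using key
  have hloc : ∀ z, z ∈ e '' K → Wt' =ᶠ[𝓝 z] Wt := fun z hzK ↦ by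
    filter_upwards [hθ1.filter_mono (nhds_le_nhdsSet hzK)] with y hy
    simp only [hWt', hy, ofReal_one, one_mul]
  have hF : ∀ (i : ι) (v : ι → ℂ) (z : ι → ℂ), z ∈ e.target →
      f i (e.symm z) * delAlong v Wt' z = f i (e.symm z) * delAlong v Wt z := fun i v z hz ↦ by
    by_cases hxK : e.symm z ∈ K
    · rw [delAlong_congr_of_eventuallyEq (hloc z ⟨e.symm z, hxK, e.right_inv hz⟩) v]
    · rw [hf0 i _ hxK, zero_mul, zero_mul]
  have hH : ∀ z ∈ e.target, W.divDatum f t (e.symm z) * Wt' z = W.divDatum f t (e.symm z) * Wt z := fun z hz ↦ by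
    by_cases hxK : e.symm z ∈ K
    · rw [(hloc z ⟨e.symm z, hxK, e.right_inv hz⟩).self_of_nhds]
    · rw [divDatum_eq_zero hf0 ht0 hxK, zero_mul, zero_mul]
  have hL : ∫ z, ∑ j, rep e (f j) z * delAlong (Pi.single j 1) Wt z =
      ∫ z in e.target, ∑ j, f j (e.symm z) * delAlong (Pi.single j 1) Wt' z := by
    rw [← integral_indicator e.open_target.measurableSet]
    refine integral_congr_ae (ae_of_all _ fun z ↦ ?_)
    change ∑ j, rep e (f j) z * delAlong (Pi.single j 1) Wt z =
      e.target.indicator (fun z ↦ ∑ j, f j (e.symm z) * delAlong (Pi.single j 1) Wt' z) z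
    by_cases hz : z ∈ e.target
    · rw [indicator_of_mem hz]
      exact Finset.sum_congr rfl fun j _ ↦ by rw [rep_apply_of_mem hz, hF j _ z hz]
    · rw [indicator_of_notMem hz]
      exact Finset.sum_eq_zero fun j _ ↦ by rw [rep_apply_of_notMem hz, zero_mul]
  have hR : ∫ z, rep e (W.divDatum f t) z * Wt z = ∫ z in e.target, W.divDatum f t (e.symm z) * Wt' z := by
    rw [integral_rep_mul]
    exact setIntegral_congr_fun e.open_target.measurableSet fun z hz ↦ (hH z hz).symm
  rw [hL, hR, key']

end GraphData

end Weights

/-! ### Mollified test forms in a flat chart -/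

section Mollify

variable {e : OpenPartialHomeomorph D (ι → ℂ)} {K : Set D} {r : ℝ} {ρ : (ι → ℂ) → ℝ}

variable (e ρ) in
/-- **The mollified form** `g_j = (ρ ⋆ F_j) ∘ proj` on `e.source` (zero elsewhere), `F_j = rep e f_j`.
[cite: HormanderSCV1973, Lemma 4.1.3 (proof, p. 80–81)] -/
def mollForm (f : ι → D → ℂ) (j : ι) : D → ℂ :=
  e.source.indicator ((ρ ⋆[lsmul ℝ ℝ, volume] rep e (f j)) ∘ D.proj)

/-- The support of a mollification of a representative: inside the `r`-neighbourhood of `e(K)`.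
[folklore] -/
theorem tsupport_conv_rep_subset (hK : IsCompact K) (hKe : K ⊆ e.source) (hρr : tsupport ρ ⊆ Metric.closedBall 0 r)
    {u : D → ℂ} (hu0 : ∀ x ∉ K, u x = 0) :
    tsupport (ρ ⋆[lsmul ℝ ℝ, volume] rep e u) ⊆ Metric.cthickening r (e '' K) := by
  refine (WirtingerMollification.tsupport_convolution_subset_cthickening hρr _).trans (Metric.cthickening_subset_of_subset r ?_)
  exact closure_minimal (support_rep_subset hu0) (isCompact_image hK hKe).1.isClosed

/-- A mollification of a representative vanishes off the `r`-neighbourhood of `e(K)`. [folklore] -/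
theorem conv_rep_eq_zero (hK : IsCompact K) (hKe : K ⊆ e.source) (hρr : tsupport ρ ⊆ Metric.closedBall 0 r)
    {u : D → ℂ} (hu0 : ∀ x ∉ K, u x = 0) {z : ι → ℂ} (hz : z ∉ Metric.cthickening r (e '' K)) :
    (ρ ⋆[lsmul ℝ ℝ, volume] rep e u) z = 0 :=
  image_eq_zero_of_notMem_tsupport fun h ↦ hz (tsupport_conv_rep_subset hK hKe hρr hu0 h)

variable (he : ⇑e = D.proj) (hK : IsCompact K) (hKe : K ⊆ e.source) (hr : Metric.cthickening r (e '' K) ⊆ e.target)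
  (hρ : ContDiff ℝ ∞ ρ) (hρc : HasCompactSupport ρ) (hρr : tsupport ρ ⊆ Metric.closedBall 0 r)

include hK hKe in
/-- The compact set `e⁻¹(cthickening r (e K)) ⊆ e.source` carrying all supports, when
`cthickening r (e K) ⊆ e.target`. [folklore] -/
theorem isCompact_symm_image_cthickening (hr : Metric.cthickening r (e '' K) ⊆ e.target) :
    IsCompact (e.symm '' Metric.cthickening r (e '' K)) ∧ e.symm '' Metric.cthickening r (e '' K) ⊆ e.source ∧
      K ⊆ e.symm '' Metric.cthickening r (e '' K) := by
  refine ⟨(isCompact_image hK hKe).1.cthickening.image_of_continuousOn (e.continuousOn_symm.mono hr),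
    fun _ ⟨z, hz, hzx⟩ ↦ hzx ▸ e.map_target (hr hz), fun x hx ↦ ?_⟩
  exact ⟨e x, Metric.self_subset_cthickening _ ⟨x, hx, rfl⟩, e.left_inv (hKe hx)⟩

include he hK hKe hr hρ hρc hρr in
/-- **The mollified form is a test form** supported in `e.source`. [cite: HormanderSCV1973, Lemma 4.1.3 (proof, p. 81)] -/
theorem isTest_mollForm {φ : D → ℝ} (hφ : Continuous φ) {f : ι → D → ℂ} (hf0 : ∀ j x, x ∉ K → f j x = 0)
    (hf : ∀ j, MemLp (f j) 2 (D.volW φ)) (j : ι) :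
    IsTest (mollForm e ρ f j) ∧ tsupport (mollForm e ρ f j) ⊆ e.source :=
  isTest_indicator_comp_proj he (WirtingerMollification.contDiff_convolution hρ hρc
    (locallyIntegrable_rep he hφ hK hKe (hf0 j) (hf j))) (hρc.convolution _ (hasCompactSupport_rep hK hKe (hf0 j)))
    ((tsupport_conv_rep_subset hK hKe hρr (hf0 j)).trans hr)

include he hK hKe hr hρr in
/-- The representative of the mollified form is the mollification of the representative. [folklore] -/
theorem rep_mollForm {f : ι → D → ℂ} (hf0 : ∀ j x, x ∉ K → f j x = 0) (j : ι) :
    rep e (mollForm e ρ f j) = ρ ⋆[lsmul ℝ ℝ, volume] rep e (f j) := by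
  funext z
  by_cases hz : z ∈ e.target
  · rw [rep_apply_of_mem hz, mollForm, indicator_comp_proj_symm he hz]
  · rw [rep_apply_of_notMem hz, conv_rep_eq_zero hK hKe hρr (hf0 j) fun h ↦ hz (hr h)]

include he hK hKe hρr in
/-- The mollified form vanishes off `e⁻¹(cthickening r (e K))`. [folklore] -/
theorem mollForm_eq_zero {f : ι → D → ℂ} (hf0 : ∀ j x, x ∉ K → f j x = 0) (j : ι) {x : D}
    (hx : x ∉ e.symm '' Metric.cthickening r (e '' K)) : mollForm e ρ f j x = 0 := by
  by_cases hxs : x ∈ e.source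
  · rw [mollForm, indicator_comp_proj_of_mem hxs, ← he]
    refine conv_rep_eq_zero hK hKe hρr (hf0 j) fun h ↦ hx ⟨e x, h, e.left_inv hxs⟩
  · rw [mollForm, indicator_of_notMem hxs]

include he hK hKe hr hρr in
/-- The topological support of the mollified form lies in `e⁻¹(cthickening r (e K))`. [folklore] -/
theorem tsupport_mollForm_subset {f : ι → D → ℂ} (hf0 : ∀ j x, x ∉ K → f j x = 0) (j : ι) :
    tsupport (mollForm e ρ f j) ⊆ e.symm '' Metric.cthickening r (e '' K) :=
  closure_minimal (fun _ hx ↦ by_contra fun h ↦ hx (mollForm_eq_zero he hK hKe hρr hf0 j h))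
    (isCompact_symm_image_cthickening hK hKe hr).1.isClosed

include he hK hKe hr hρr in
/-- Flat derivatives of the mollified form vanish off `e⁻¹(cthickening r (e K))`. [folklore] -/
theorem dbar_mollForm_eq_zero {f : ι → D → ℂ} (hf0 : ∀ j x, x ∉ K → f j x = 0) (j : ι) (v : ι → ℂ) {x : D}
    (hx : x ∉ e.symm '' Metric.cthickening r (e '' K)) : dbar v (mollForm e ρ f j) x = 0 :=
  notMem_support.1 fun h ↦ hx (tsupport_mollForm_subset he hK hKe hr hρr hf0 j (support_dbar_subset v _ h))

include he hK hKe hr hρr in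
/-- Flat `∂`-derivatives of the mollified form vanish off `e⁻¹(cthickening r (e K))`. [folklore] -/
theorem del_mollForm_eq_zero {f : ι → D → ℂ} (hf0 : ∀ j x, x ∉ K → f j x = 0) (j : ι) (v : ι → ℂ) {x : D}
    (hx : x ∉ e.symm '' Metric.cthickening r (e '' K)) : del v (mollForm e ρ f j) x = 0 :=
  notMem_support.1 fun h ↦ hx (tsupport_mollForm_subset he hK hKe hr hρr hf0 j (support_del_subset v _ h))

/-- `∂̄_v` of the mollified form at `e⁻¹ z`. [folklore] -/
theorem dbar_mollForm_symm (he : ⇑e = D.proj) (f : ι → D → ℂ) (j : ι) {z : ι → ℂ} (hz : z ∈ e.target) (v : ι → ℂ) :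
    dbar v (mollForm e ρ f j) (e.symm z) = dbarAlong v (ρ ⋆[lsmul ℝ ℝ, volume] rep e (f j)) z :=
  dbar_indicator_comp_proj he _ hz v

/-- `∂_v` of the mollified form at `e⁻¹ z`. [folklore] -/
theorem del_mollForm_symm (he : ⇑e = D.proj) (f : ι → D → ℂ) (j : ι) {z : ι → ℂ} (hz : z ∈ e.target) (v : ι → ℂ) :
    del v (mollForm e ρ f j) (e.symm z) = delAlong v (ρ ⋆[lsmul ℝ ℝ, volume] rep e (f j)) z :=
  del_indicator_comp_proj he _ hz v

/-- The mollified form at `e⁻¹ z`. [folklore] -/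
theorem mollForm_symm (he : ⇑e = D.proj) (f : ι → D → ℂ) (j : ι) {z : ι → ℂ} (hz : z ∈ e.target) :
    mollForm e ρ f j (e.symm z) = (ρ ⋆[lsmul ℝ ℝ, volume] rep e (f j)) z :=
  indicator_comp_proj_symm he hz

end Mollify

/-! ### The three graph errors of the mollified form, read in the chart -/

namespace Weights

namespace GraphData

variable [DecidableEq ι] {W : Weights D} {f : ι → D → ℂ} {t : D → ℂ} {s : ι → ι → D → ℂ}
variable {e : OpenPartialHomeomorph D (ι → ℂ)} {K : Set D} {r : ℝ} {ρ : (ι → ℂ) → ℝ}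
  (h : W.GraphData f t s) (h₂ : ContMDiff 𝓘(ℝ, ι → ℂ) 𝓘(ℝ, ℝ) ∞ W.φ₂)
  (he : ⇑e = D.proj) (hK : IsCompact K) (hKe : K ⊆ e.source) (hr : Metric.cthickening r (e '' K) ⊆ e.target)
  (hρ : ContDiff ℝ ∞ ρ) (hρc : HasCompactSupport ρ) (hρr : tsupport ρ ⊆ Metric.closedBall 0 r)
  (hf0 : ∀ j x, x ∉ K → f j x = 0) (ht0 : ∀ x ∉ K, t x = 0) (hs0 : ∀ j k x, x ∉ K → s j k x = 0)

omit [DecidableEq ι] in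
include he hK hKe hr hρr hf0 in
/-- **The `f`-error in the chart**: `rep (g_j - f_j) = ρ ⋆ F_j - F_j`. [folklore] -/
theorem rep_mollForm_sub :
    ∀ j, rep e (fun x ↦ mollForm e ρ f j x - f j x) =
      fun z ↦ (ρ ⋆[lsmul ℝ ℝ, volume] rep e (f j)) z - rep e (f j) z := fun j ↦ by
  rw [rep_sub, rep_mollForm he hK hKe hr hρr hf0 j]

include h he hK hKe hr hρ hρc hρr hf0 hs0 in
/-- **The `S`-error in the chart**: `rep (∂̄_j g_k - ∂̄_k g_j - s_{jk}) = ρ ⋆ S_{jk} - S_{jk}` (Friedrichs: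
`S(f ⋆ ρ) = (Sf) ⋆ ρ`). [cite: HormanderSCV1973, Lemma 4.1.3 (proof, p. 81)] -/
theorem rep_dbar_mollForm_sub (j k : ι) :
    rep e (fun x ↦ (dbar (Pi.single j 1) (mollForm e ρ f k) x - dbar (Pi.single k 1) (mollForm e ρ f j) x) - s j k x) =
      fun z ↦ (ρ ⋆[lsmul ℝ ℝ, volume] rep e (s j k)) z - rep e (s j k) z := by
  have hF : ∀ i, LocallyIntegrable (rep e (f i)) volume := fun i ↦
    locallyIntegrable_rep he W.continuous₂ hK hKe (hf0 i) (h.memLp_f i)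
  funext z
  by_cases hz : z ∈ e.target
  · rw [rep_apply_of_mem hz, rep_apply_of_mem hz, dbar_mollForm_symm he, dbar_mollForm_symm he,
      WirtingerMollification.dbarAlong_convolution_sub_eq (hF j) (hF k) (Pi.single j 1) (Pi.single k 1)
        (fun Wt hWt hWtc ↦ h.weakS_rep he hK hKe hf0 hs0 j k hWt hWtc) hρ hρc z]
    · exact hz
    · exact hz
  · rw [rep_apply_of_notMem hz, rep_apply_of_notMem hz, sub_zero,
      conv_rep_eq_zero hK hKe hρr (hs0 j k) fun h' ↦ hz (hr h')]

include h h₂ he hK hKe hρ hρc hf0 ht0 in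
/-- **The `T*`-error in the chart**: with `E = e^{φ₁-φ₂}`, `H₀ = rep h₀`,
`rep (ϑ g - t) = -rep E · ((ρ ⋆ H₀ - H₀) - ∑_j (ρ ⋆ F_j - F_j) · rep (∂_j φ₂))` (Friedrichs for the
constant-coefficient part `∑ ∂_j`, the zero-order part carried along).
[cite: HormanderSCV1973, Lemma 4.1.3 (proof, p. 81)] -/
theorem rep_formalAdjoint_mollForm_sub :
    rep e (fun x ↦ W.formalAdjoint (mollForm e ρ f) x - t x) = fun z ↦
      -rep e (fun x ↦ (Real.exp (W.φ₁ x - W.φ₂ x) : ℂ)) z *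
        (((ρ ⋆[lsmul ℝ ℝ, volume] rep e (W.divDatum f t)) z - rep e (W.divDatum f t) z) -
          ∑ j, ((ρ ⋆[lsmul ℝ ℝ, volume] rep e (f j)) z - rep e (f j) z) *
            rep e (fun x ↦ del (Pi.single j 1) (fun y ↦ (W.φ₂ y : ℂ)) x) z) := by
  have hF : ∀ i, LocallyIntegrable (rep e (f i)) volume := fun i ↦
    locallyIntegrable_rep he W.continuous₂ hK hKe (hf0 i) (h.memLp_f i)
  funext z
  by_cases hz : z ∈ e.target
  · simp only [rep_apply_of_mem hz]
    rw [formalAdjoint]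
    have hsum := WirtingerMollification.sum_delAlong_convolution_eq hF (fun j ↦ Pi.single j 1)
      (fun Wt hWt hWtc ↦ h.weakT_rep h₂ he hK hKe hf0 ht0 hWt hWtc) hρ hρc z
    simp_rw [del_mollForm_symm he f _ hz, mollForm_symm he f _ hz]
    rw [Finset.sum_sub_distrib, hsum]
    have ht : t (e.symm z) = -(Real.exp (W.φ₁ (e.symm z) - W.φ₂ (e.symm z)) : ℂ) *
        (W.divDatum f t (e.symm z) - ∑ j, f j (e.symm z) * del (Pi.single j 1) (fun y ↦ (W.φ₂ y : ℂ)) (e.symm z)) := by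
      rw [divDatum, add_sub_cancel_right]
      have hE : (Real.exp (W.φ₁ (e.symm z) - W.φ₂ (e.symm z)) : ℂ) * (Real.exp (W.φ₂ (e.symm z) - W.φ₁ (e.symm z)) : ℂ) = 1 := by
        rw [← ofReal_mul, ← Real.exp_add]; norm_num
      linear_combination (-t (e.symm z)) * hE
    rw [ht]
    have : ∑ j, ((ρ ⋆[lsmul ℝ ℝ, volume] rep e (f j)) z - f j (e.symm z)) * del (Pi.single j 1) (fun y ↦ (W.φ₂ y : ℂ)) (e.symm z) =
        ∑ j, (ρ ⋆[lsmul ℝ ℝ, volume] rep e (f j)) z * del (Pi.single j 1) (fun y ↦ (W.φ₂ y : ℂ)) (e.symm z) -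
          ∑ j, f j (e.symm z) * del (Pi.single j 1) (fun y ↦ (W.φ₂ y : ℂ)) (e.symm z) := by
      rw [← Finset.sum_sub_distrib]; exact Finset.sum_congr rfl fun j _ ↦ by ring
    rw [this]; ring
  · simp only [rep_apply_of_notMem hz]
    ring

omit [DecidableEq ι] in
include he hK hKe hr hρ hρc hρr hf0 in
/-- **The `f`-error of the mollified form is controlled by the flat `L²`-error of the mollification.**
[cite: HormanderSCV1973, Lemma 4.1.3 (proof, p. 81)] -/
theorem eLpNorm_mollForm_sub_le {φ : D → ℝ} (hφ : Continuous φ) (hfm : ∀ j, AEStronglyMeasurable (f j) D.vol)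
    (hf : ∀ j, MemLp (f j) 2 (D.volW φ)) {M : ℝ}
    (hM : ∀ x ∈ e.symm '' Metric.cthickening r (e '' K), Real.exp (-φ x) ≤ M) (j : ι) :
    eLpNorm (fun x ↦ mollForm e ρ f j x - f j x) 2 (D.volW φ) ≤ ENNReal.ofReal M ^ (1 / 2 : ℝ) *
      eLpNorm (fun z ↦ (ρ ⋆[lsmul ℝ ℝ, volume] rep e (f j)) z - rep e (f j) z) 2 volume := by
  obtain ⟨hKDc, hKDe, hKKD⟩ := isCompact_symm_image_cthickening hK hKe hr
  have hg := isTest_mollForm he hK hKe hr hρ hρc hρr hφ hf0 hf j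
  rw [← rep_mollForm_sub he hK hKe hr hρr hf0 j]
  refine eLpNorm_volW_le_rep he hφ hKDe hM (hg.1.continuous.aestronglyMeasurable.sub (hfm j)) fun x hx ↦ ?_
  rw [mollForm_eq_zero he hK hKe hρr hf0 j hx, hf0 j x fun h ↦ hx (hKKD h), sub_zero]

include h he hK hKe hr hρ hρc hρr hf0 hs0 in
/-- **The `S`-error of the mollified form is controlled by the flat `L²`-error of `ρ ⋆ S_{jk}`.**
[cite: HormanderSCV1973, Lemma 4.1.3 (proof, p. 81)] -/
theorem eLpNorm_dbar_mollForm_sub_le {M : ℝ} (hM : ∀ x ∈ e.symm '' Metric.cthickening r (e '' K), Real.exp (-W.φ₃ x) ≤ M) (j k : ι) :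
    eLpNorm (fun x ↦ (dbar (Pi.single j 1) (mollForm e ρ f k) x - dbar (Pi.single k 1) (mollForm e ρ f j) x) - s j k x) 2 W.μ₃ ≤
      ENNReal.ofReal M ^ (1 / 2 : ℝ) * eLpNorm (fun z ↦ (ρ ⋆[lsmul ℝ ℝ, volume] rep e (s j k)) z - rep e (s j k) z) 2 volume := by
  obtain ⟨hKDc, hKDe, hKKD⟩ := isCompact_symm_image_cthickening hK hKe hr
  have hg := fun i ↦ isTest_mollForm he hK hKe hr hρ hρc hρr W.continuous₂ hf0 h.memLp_f i
  rw [← h.rep_dbar_mollForm_sub he hK hKe hr hρ hρc hρr hf0 hs0 j k]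
  refine eLpNorm_volW_le_rep he W.continuous₃ hKDe hM
    ((((hg k).1.dbar _).continuous.sub ((hg j).1.dbar _).continuous).aestronglyMeasurable.sub (h.aestronglyMeasurable_s j k))
    fun x hx ↦ ?_
  rw [dbar_mollForm_eq_zero he hK hKe hr hρr hf0 k _ hx, dbar_mollForm_eq_zero he hK hKe hr hρr hf0 j _ hx,
    hs0 j k x fun h' ↦ hx (hKKD h'), sub_zero, sub_zero]

omit [DecidableEq ι] in
/-- The formal adjoint of a test form is continuous (`φ₂` smooth, `φ₁` continuous). [folklore] -/
theorem continuous_formalAdjoint [DecidableEq ι] (h₂ : ContMDiff 𝓘(ℝ, ι → ℂ) 𝓘(ℝ, ℝ) ∞ W.φ₂) {g : ι → D → ℂ}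
    (hg : ∀ j, IsTest (g j)) : Continuous (W.formalAdjoint g) := by
  have : W.formalAdjoint g = fun x ↦ -(Real.exp (W.φ₁ x - W.φ₂ x) : ℂ) *
      ∑ j, (del (Pi.single j 1) (g j) x - g j x * del (Pi.single j 1) (fun y ↦ (W.φ₂ y : ℂ)) x) := rfl
  rw [this]
  exact (continuous_ofReal.comp (Real.continuous_exp.comp (W.continuous₁.sub W.continuous₂))).neg.mul
    (continuous_finsetSum _ fun j _ ↦ ((hg j).del _).continuous.sub
      ((hg j).continuous.mul (contMDiff_del (contMDiff_ofReal h₂) _).continuous))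

include h h₂ he hK hKe hr hρ hρc hρr hf0 ht0 in
/-- **The `T*`-error of the mollified form is controlled by the flat `L²`-errors of `ρ ⋆ H₀` and
`ρ ⋆ F_j`.** [cite: HormanderSCV1973, Lemma 4.1.3 (proof, p. 81)] -/
theorem eLpNorm_formalAdjoint_mollForm_sub_le {M : ℝ}
    (hM : ∀ x ∈ e.symm '' Metric.cthickening r (e '' K), Real.exp (-W.φ₁ x) ≤ M) {CE : ℝ}
    (hCE : ∀ Ψ : (ι → ℂ) → ℂ, (∀ z ∉ Metric.cthickening r (e '' K), Ψ z = 0) →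
      eLpNorm (fun z ↦ rep e (fun x ↦ (Real.exp (W.φ₁ x - W.φ₂ x) : ℂ)) z * Ψ z) 2 volume ≤ ENNReal.ofReal CE * eLpNorm Ψ 2 volume)
    {Cd : ι → ℝ} (hCd : ∀ (j : ι) (Ψ : (ι → ℂ) → ℂ), (∀ z ∉ Metric.cthickening r (e '' K), Ψ z = 0) →
      eLpNorm (fun z ↦ rep e (fun x ↦ del (Pi.single j 1) (fun y ↦ (W.φ₂ y : ℂ)) x) z * Ψ z) 2 volume ≤
        ENNReal.ofReal (Cd j) * eLpNorm Ψ 2 volume) :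
    eLpNorm (fun x ↦ W.formalAdjoint (mollForm e ρ f) x - t x) 2 W.μ₁ ≤
      ENNReal.ofReal M ^ (1 / 2 : ℝ) * (ENNReal.ofReal CE *
        (eLpNorm (fun z ↦ (ρ ⋆[lsmul ℝ ℝ, volume] rep e (W.divDatum f t)) z - rep e (W.divDatum f t) z) 2 volume +
          ∑ j, ENNReal.ofReal (Cd j) * eLpNorm (fun z ↦ (ρ ⋆[lsmul ℝ ℝ, volume] rep e (f j)) z - rep e (f j) z) 2 volume)) := by
  obtain ⟨hKDc, hKDe, hKKD⟩ := isCompact_symm_image_cthickening hK hKe hr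
  have hg := fun i ↦ isTest_mollForm he hK hKe hr hρ hρc hρr W.continuous₂ hf0 h.memLp_f i
  -- supports of the flat errors
  have hdiv0 : ∀ x ∉ K, W.divDatum f t x = 0 := fun x hx ↦ divDatum_eq_zero hf0 ht0 hx
  have hK₁ : e '' K ⊆ Metric.cthickening r (e '' K) := Metric.self_subset_cthickening _
  have hΨH : ∀ z ∉ Metric.cthickening r (e '' K),
      (ρ ⋆[lsmul ℝ ℝ, volume] rep e (W.divDatum f t)) z - rep e (W.divDatum f t) z = 0 := fun z hz ↦ by
    rw [conv_rep_eq_zero hK hKe hρr hdiv0 hz, rep_eq_zero_of_notMem_image hdiv0 fun h' ↦ hz (hK₁ h'), sub_zero]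
  have hΨF : ∀ j, ∀ z ∉ Metric.cthickening r (e '' K),
      (ρ ⋆[lsmul ℝ ℝ, volume] rep e (f j)) z - rep e (f j) z = 0 := fun j z hz ↦ by
    rw [conv_rep_eq_zero hK hKe hρr (hf0 j) hz, rep_eq_zero_of_notMem_image (hf0 j) fun h' ↦ hz (hK₁ h'), sub_zero]
  -- measurability of the flat errors
  have hlocF : ∀ j, LocallyIntegrable (rep e (f j)) volume := fun j ↦
    locallyIntegrable_rep he W.continuous₂ hK hKe (hf0 j) (h.memLp_f j)
  have hlocH : LocallyIntegrable (rep e (W.divDatum f t)) volume :=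
    locallyIntegrable_rep he W.continuous₁ hK hKe hdiv0 (h.memLp_divDatum h₂ hK hf0 ht0)
  have hmH : AEStronglyMeasurable (fun z ↦ (ρ ⋆[lsmul ℝ ℝ, volume] rep e (W.divDatum f t)) z - rep e (W.divDatum f t) z) volume :=
    (WirtingerMollification.contDiff_convolution hρ hρc hlocH).continuous.aestronglyMeasurable.sub hlocH.aestronglyMeasurable
  have hmF : ∀ j, AEStronglyMeasurable (fun z ↦ ((ρ ⋆[lsmul ℝ ℝ, volume] rep e (f j)) z - rep e (f j) z) *
      rep e (fun x ↦ del (Pi.single j 1) (fun y ↦ (W.φ₂ y : ℂ)) x) z) volume := fun j ↦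
    ((WirtingerMollification.contDiff_convolution hρ hρc (hlocF j)).continuous.aestronglyMeasurable.sub
      (hlocF j).aestronglyMeasurable).mul
      (aestronglyMeasurable_rep he (contMDiff_del (contMDiff_ofReal h₂) _).continuous.aestronglyMeasurable)
  -- Step 1: to the chart
  have h1 : eLpNorm (fun x ↦ W.formalAdjoint (mollForm e ρ f) x - t x) 2 W.μ₁ ≤ ENNReal.ofReal M ^ (1 / 2 : ℝ) *
      eLpNorm (rep e (fun x ↦ W.formalAdjoint (mollForm e ρ f) x - t x)) 2 volume := by
    refine eLpNorm_volW_le_rep he W.continuous₁ hKDe hM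
      ((continuous_formalAdjoint h₂ fun j ↦ (hg j).1).aestronglyMeasurable.sub h.aestronglyMeasurable_t) fun x hx ↦ ?_
    rw [ht0 x fun h' ↦ hx (hKKD h'), sub_zero, formalAdjoint]
    rw [Finset.sum_eq_zero fun j _ ↦ by
      rw [del_mollForm_eq_zero he hK hKe hr hρr hf0 j _ hx, mollForm_eq_zero he hK hKe hρr hf0 j hx]; ring]
    rw [mul_zero]
  refine h1.trans ?_
  gcongr
  -- Step 2: the multiplier `-rep E`
  rw [h.rep_formalAdjoint_mollForm_sub h₂ he hK hKe hρ hρc hf0 ht0]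
  set Ψ : (ι → ℂ) → ℂ := fun z ↦ ((ρ ⋆[lsmul ℝ ℝ, volume] rep e (W.divDatum f t)) z - rep e (W.divDatum f t) z) -
    ∑ j, ((ρ ⋆[lsmul ℝ ℝ, volume] rep e (f j)) z - rep e (f j) z) *
      rep e (fun x ↦ del (Pi.single j 1) (fun y ↦ (W.φ₂ y : ℂ)) x) z with hΨ
  have hΨ0 : ∀ z ∉ Metric.cthickening r (e '' K), Ψ z = 0 := fun z hz ↦ by
    simp only [hΨ, hΨH z hz, hΨF _ z hz, zero_mul, Finset.sum_const_zero, sub_zero]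
  have h2 : eLpNorm (fun z ↦ -rep e (fun x ↦ (Real.exp (W.φ₁ x - W.φ₂ x) : ℂ)) z * Ψ z) 2 volume ≤
      ENNReal.ofReal CE * eLpNorm Ψ 2 volume := by
    have : (fun z ↦ -rep e (fun x ↦ (Real.exp (W.φ₁ x - W.φ₂ x) : ℂ)) z * Ψ z) =
        -fun z ↦ rep e (fun x ↦ (Real.exp (W.φ₁ x - W.φ₂ x) : ℂ)) z * Ψ z := by
      funext z; simp only [Pi.neg_apply, neg_mul]
    rw [this, eLpNorm_neg]
    exact hCE Ψ hΨ0
  refine h2.trans ?_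
  gcongr
  -- Step 3: triangle inequality and the multipliers `rep (∂_j φ₂)`
  have h3 : eLpNorm Ψ 2 volume ≤
      eLpNorm (fun z ↦ (ρ ⋆[lsmul ℝ ℝ, volume] rep e (W.divDatum f t)) z - rep e (W.divDatum f t) z) 2 volume +
        eLpNorm (fun z ↦ ∑ j, ((ρ ⋆[lsmul ℝ ℝ, volume] rep e (f j)) z - rep e (f j) z) *
          rep e (fun x ↦ del (Pi.single j 1) (fun y ↦ (W.φ₂ y : ℂ)) x) z) 2 volume :=
    eLpNorm_sub_le hmH (Finset.aestronglyMeasurable_fun_sum _ fun j _ ↦ hmF j) one_le_two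
  refine h3.trans ?_
  gcongr
  have h4 : (fun z ↦ ∑ j, ((ρ ⋆[lsmul ℝ ℝ, volume] rep e (f j)) z - rep e (f j) z) *
      rep e (fun x ↦ del (Pi.single j 1) (fun y ↦ (W.φ₂ y : ℂ)) x) z) =
      ∑ j, fun z ↦ ((ρ ⋆[lsmul ℝ ℝ, volume] rep e (f j)) z - rep e (f j) z) *
        rep e (fun x ↦ del (Pi.single j 1) (fun y ↦ (W.φ₂ y : ℂ)) x) z := by
    funext z; simp only [Finset.sum_apply]
  rw [h4]
  refine (eLpNorm_sum_le (fun j _ ↦ hmF j) one_le_two).trans (Finset.sum_le_sum fun j _ ↦ ?_)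
  have h5 : (fun z ↦ ((ρ ⋆[lsmul ℝ ℝ, volume] rep e (f j)) z - rep e (f j) z) *
      rep e (fun x ↦ del (Pi.single j 1) (fun y ↦ (W.φ₂ y : ℂ)) x) z) =
      fun z ↦ rep e (fun x ↦ del (Pi.single j 1) (fun y ↦ (W.φ₂ y : ℂ)) x) z *
        ((ρ ⋆[lsmul ℝ ℝ, volume] rep e (f j)) z - rep e (f j) z) := by
    funext z; ring
  rw [h5]
  exact hCd j _ (hΨF j)

end GraphData

/-! ### Graph-norm approximation by test forms: bookkeeping -/

section Approx

variable [DecidableEq ι] (W : Weights D)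

/-- **`ε`-approximation in the graph norm by a test form**: there is a test form `g` with
`‖g - f‖_{φ₂} ≤ ε`, `‖ϑ g - t‖_{φ₁} ≤ ε` and `‖S g - s‖_{φ₃} ≤ ε` (componentwise).
[cite: HormanderSCV1973, Lemma 4.1.3] -/
def Approx (f : ι → D → ℂ) (t : D → ℂ) (s : ι → ι → D → ℂ) (ε : ℝ≥0∞) : Prop :=
  ∃ g : ι → D → ℂ, (∀ j, IsTest (g j)) ∧ (∀ j, eLpNorm (fun x ↦ g j x - f j x) 2 W.μ₂ ≤ ε) ∧
    eLpNorm (fun x ↦ W.formalAdjoint g x - t x) 2 W.μ₁ ≤ ε ∧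
    ∀ j k, eLpNorm (fun x ↦ (dbar (Pi.single j 1) (g k) x - dbar (Pi.single k 1) (g j) x) - s j k x) 2 W.μ₃ ≤ ε

variable {W}
variable {f f' : ι → D → ℂ} {t t' : D → ℂ} {s s' : ι → ι → D → ℂ} {ε ε' δ : ℝ≥0∞}

/-- Monotonicity in `ε`. [folklore] -/
theorem Approx.mono (h : W.Approx f t s ε) (hle : ε ≤ ε') : W.Approx f t s ε' := by
  obtain ⟨g, hg, h1, h2, h3⟩ := h
  exact ⟨g, hg, fun j ↦ (h1 j).trans hle, h2.trans hle, fun j k ↦ (h3 j k).trans hle⟩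

/-- Invariance under `vol`-a.e. modification of the data. [folklore] -/
theorem Approx.congr_ae (h : W.Approx f t s ε) (hf : ∀ j, f j =ᵐ[D.vol] f' j) (ht : t =ᵐ[D.vol] t')
    (hs : ∀ j k, s j k =ᵐ[D.vol] s' j k) : W.Approx f' t' s' ε := by
  obtain ⟨g, hg, h1, h2, h3⟩ := h
  refine ⟨g, hg, fun j ↦ ?_, ?_, fun j k ↦ ?_⟩
  · have : (fun x ↦ g j x - f j x) =ᵐ[W.μ₂] fun x ↦ g j x - f' j x := by
      filter_upwards [(eventuallyEq_volW_iff W.continuous₂).2 (hf j)] with x hx; rw [hx]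
    exact le_of_eq_of_le (eLpNorm_congr_ae this).symm (h1 j)
  · have : (fun x ↦ W.formalAdjoint g x - t x) =ᵐ[W.μ₁] fun x ↦ W.formalAdjoint g x - t' x := by
      filter_upwards [(eventuallyEq_volW_iff W.continuous₁).2 ht] with x hx; rw [hx]
    exact le_of_eq_of_le (eLpNorm_congr_ae this).symm h2
  · have : (fun x ↦ (dbar (Pi.single j 1) (g k) x - dbar (Pi.single k 1) (g j) x) - s j k x) =ᵐ[W.μ₃]
        fun x ↦ (dbar (Pi.single j 1) (g k) x - dbar (Pi.single k 1) (g j) x) - s' j k x := by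
      filter_upwards [(eventuallyEq_volW_iff W.continuous₃).2 (hs j k)] with x hx; rw [hx]
    exact le_of_eq_of_le (eLpNorm_congr_ae this).symm (h3 j k)

/-- The zero form approximates the zero data exactly. [folklore] -/
theorem approx_zero : W.Approx (fun _ _ ↦ 0) (fun _ ↦ 0) (fun _ _ _ ↦ 0) 0 := by
  have h0 : eLpNorm (fun _ : D ↦ (0 : ℂ) - 0) 2 W.μ₂ ≤ 0 := by simp
  have h0' : eLpNorm (fun _ : D ↦ (0 : ℂ) - 0) 2 W.μ₃ ≤ 0 := by simp
  have hT : W.formalAdjoint (fun (_ : ι) (_ : D) ↦ (0 : ℂ)) = fun _ ↦ 0 := by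
    funext x; simp [formalAdjoint, del_const]
  refine ⟨fun _ _ ↦ 0, fun _ ↦ IsTest.zero', fun j ↦ h0, ?_, fun j k ↦ ?_⟩
  · rw [hT]; simp
  · have : (fun x : D ↦ (dbar (Pi.single j 1) (fun _ : D ↦ (0 : ℂ)) x - dbar (Pi.single k 1) (fun _ : D ↦ (0 : ℂ)) x) - 0) =
        fun _ ↦ (0 : ℂ) - 0 := by
      funext x; rw [dbar_const, dbar_const]; ring
    exact le_of_eq_of_le (congrArg (eLpNorm · 2 W.μ₃) this) h0'

/-- The formal adjoint is additive on test forms. [folklore] -/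
theorem formalAdjoint_add {g g' : ι → D → ℂ} (hg : ∀ j, IsTest (g j)) (hg' : ∀ j, IsTest (g' j)) (x : D) :
    W.formalAdjoint (fun j y ↦ g j y + g' j y) x = W.formalAdjoint g x + W.formalAdjoint g' x := by
  simp only [formalAdjoint]
  rw [← mul_add, ← Finset.sum_add_distrib]
  congr 1
  refine Finset.sum_congr rfl fun j _ ↦ ?_
  rw [show (fun y ↦ g j y + g' j y) = g j + g' j from rfl,
    del_add (differentiableAt_comp_symm_of_contMDiff (hg j).contMDiff x) (differentiableAt_comp_symm_of_contMDiff (hg' j).contMDiff x)]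
  ring

omit [DecidableEq ι] in
/-- `∂̄_v` is additive on test functions. [folklore] -/
theorem dbar_add_isTest {u w : D → ℂ} (hu : IsTest u) (hw : IsTest w) (v : ι → ℂ) (x : D) :
    dbar v (fun y ↦ u y + w y) x = dbar v u x + dbar v w x := by
  rw [show (fun y ↦ u y + w y) = u + w from rfl,
    dbar_add (differentiableAt_comp_symm_of_contMDiff hu.contMDiff x) (differentiableAt_comp_symm_of_contMDiff hw.contMDiff x)]

omit [DecidableEq ι] in
/-- AE-strong measurability for a weighted measure from that for `vol`. [folklore] -/
theorem aestronglyMeasurable_volW {φ : D → ℝ} {u : D → ℂ} (hu : AEStronglyMeasurable u D.vol) :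
    AEStronglyMeasurable u (D.volW φ) :=
  hu.mono_ac (volW_absolutelyContinuous φ)

/-- **Additivity of approximations.** [folklore] -/
theorem Approx.add (h₂ : ContMDiff 𝓘(ℝ, ι → ℂ) 𝓘(ℝ, ℝ) ∞ W.φ₂) (hA : W.Approx f t s ε) (hB : W.Approx f' t' s' ε')
    (hf : ∀ j, AEStronglyMeasurable (f j) D.vol) (ht : AEStronglyMeasurable t D.vol) (hs : ∀ j k, AEStronglyMeasurable (s j k) D.vol)
    (hf' : ∀ j, AEStronglyMeasurable (f' j) D.vol) (ht' : AEStronglyMeasurable t' D.vol)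
    (hs' : ∀ j k, AEStronglyMeasurable (s' j k) D.vol) :
    W.Approx (fun j x ↦ f j x + f' j x) (fun x ↦ t x + t' x) (fun j k x ↦ s j k x + s' j k x) (ε + ε') := by
  obtain ⟨g, hg, h1, h2, h3⟩ := hA
  obtain ⟨g', hg', h1', h2', h3'⟩ := hB
  have hmT : ∀ {g : ι → D → ℂ} {t : D → ℂ}, (∀ j, IsTest (g j)) → AEStronglyMeasurable t D.vol →
      AEStronglyMeasurable (fun x ↦ W.formalAdjoint g x - t x) W.μ₁ := fun hg ht ↦
    aestronglyMeasurable_volW ((GraphData.continuous_formalAdjoint h₂ hg).aestronglyMeasurable.sub ht)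
  have hmS : ∀ {g : ι → D → ℂ} {s : ι → ι → D → ℂ}, (∀ j, IsTest (g j)) → (∀ j k, AEStronglyMeasurable (s j k) D.vol) →
      ∀ j k, AEStronglyMeasurable (fun x ↦ (dbar (Pi.single j 1) (g k) x - dbar (Pi.single k 1) (g j) x) - s j k x) W.μ₃ :=
    fun hg hs j k ↦ aestronglyMeasurable_volW (((((hg k).dbar _).continuous.sub ((hg j).dbar _).continuous)).aestronglyMeasurable.sub (hs j k))
  refine ⟨fun j x ↦ g j x + g' j x, fun j ↦ (hg j).add' (hg' j), fun j ↦ ?_, ?_, fun j k ↦ ?_⟩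
  · have : (fun x ↦ (g j x + g' j x) - (f j x + f' j x)) = (fun x ↦ g j x - f j x) + fun x ↦ g' j x - f' j x := by
      funext x; simp only [Pi.add_apply]; ring
    rw [this]
    exact (eLpNorm_add_le (aestronglyMeasurable_volW ((hg j).continuous.aestronglyMeasurable.sub (hf j)))
      (aestronglyMeasurable_volW ((hg' j).continuous.aestronglyMeasurable.sub (hf' j))) one_le_two).trans (add_le_add (h1 j) (h1' j))
  · have : (fun x ↦ W.formalAdjoint (fun j x ↦ g j x + g' j x) x - (t x + t' x)) =
        (fun x ↦ W.formalAdjoint g x - t x) + fun x ↦ W.formalAdjoint g' x - t' x := by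
      funext x; simp only [Pi.add_apply, formalAdjoint_add hg hg']; ring
    rw [this]
    exact (eLpNorm_add_le (hmT hg ht) (hmT hg' ht') one_le_two).trans (add_le_add h2 h2')
  · have : (fun x ↦ (dbar (Pi.single j 1) (fun x ↦ g k x + g' k x) x - dbar (Pi.single k 1) (fun x ↦ g j x + g' j x) x) -
        (s j k x + s' j k x)) = (fun x ↦ (dbar (Pi.single j 1) (g k) x - dbar (Pi.single k 1) (g j) x) - s j k x) +
          fun x ↦ (dbar (Pi.single j 1) (g' k) x - dbar (Pi.single k 1) (g' j) x) - s' j k x := by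
      funext x; simp only [Pi.add_apply, dbar_add_isTest (hg _) (hg' _)]; ring
    rw [this]
    exact (eLpNorm_add_le (hmS hg hs j k) (hmS hg' hs' j k) one_le_two).trans (add_le_add (h3 j k) (h3' j k))

/-- **Approximations add up over a finite family.** [folklore] -/
theorem Approx.finset_sum (h₂ : ContMDiff 𝓘(ℝ, ι → ℂ) 𝓘(ℝ, ℝ) ∞ W.φ₂) {κ : Type*} (T : Finset κ)
    {f : κ → ι → D → ℂ} {t : κ → D → ℂ} {s : κ → ι → ι → D → ℂ} {ε : κ → ℝ≥0∞}
    (hA : ∀ i ∈ T, W.Approx (f i) (t i) (s i) (ε i))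
    (hf : ∀ i j, AEStronglyMeasurable (f i j) D.vol) (ht : ∀ i, AEStronglyMeasurable (t i) D.vol)
    (hs : ∀ i j k, AEStronglyMeasurable (s i j k) D.vol) :
    W.Approx (fun j x ↦ ∑ i ∈ T, f i j x) (fun x ↦ ∑ i ∈ T, t i x) (fun j k x ↦ ∑ i ∈ T, s i j k x) (∑ i ∈ T, ε i) := by
  classical
  induction T using Finset.induction_on with
  | empty => simpa using (approx_zero (W := W))
  | insert a T ha ih =>
    have e1 : (fun j x ↦ ∑ i ∈ insert a T, f i j x) = fun j x ↦ f a j x + ∑ i ∈ T, f i j x := by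
      funext j x; rw [Finset.sum_insert ha]
    have e2 : (fun x ↦ ∑ i ∈ insert a T, t i x) = fun x ↦ t a x + ∑ i ∈ T, t i x := by
      funext x; rw [Finset.sum_insert ha]
    have e3 : (fun j k x ↦ ∑ i ∈ insert a T, s i j k x) = fun j k x ↦ s a j k x + ∑ i ∈ T, s i j k x := by
      funext j k x; rw [Finset.sum_insert ha]
    rw [e1, e2, e3, Finset.sum_insert ha]
    exact (hA a (Finset.mem_insert_self a T)).add h₂ (ih fun i hi ↦ hA i (Finset.mem_insert_of_mem hi)) (hf a) (ht a) (hs a)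
      (fun j ↦ Finset.aestronglyMeasurable_fun_sum _ fun i _ ↦ hf i j) (Finset.aestronglyMeasurable_fun_sum _ fun i _ ↦ ht i)
      (fun j k ↦ Finset.aestronglyMeasurable_fun_sum _ fun i _ ↦ hs i j k)

/-- **Stability under nearby data**: an `ε`-approximation of `(f', t', s')` within `δ` of `(f, t, s)` is an
`(ε + δ)`-approximation of `(f, t, s)`. [folklore] -/
theorem Approx.of_near (h₂ : ContMDiff 𝓘(ℝ, ι → ℂ) 𝓘(ℝ, ℝ) ∞ W.φ₂) (hA : W.Approx f' t' s' ε)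
    (hf : ∀ j, AEStronglyMeasurable (f j) D.vol) (ht : AEStronglyMeasurable t D.vol) (hs : ∀ j k, AEStronglyMeasurable (s j k) D.vol)
    (hf' : ∀ j, AEStronglyMeasurable (f' j) D.vol) (ht' : AEStronglyMeasurable t' D.vol)
    (hs' : ∀ j k, AEStronglyMeasurable (s' j k) D.vol)
    (df : ∀ j, eLpNorm (fun x ↦ f' j x - f j x) 2 W.μ₂ ≤ δ) (dt : eLpNorm (fun x ↦ t' x - t x) 2 W.μ₁ ≤ δ)
    (ds : ∀ j k, eLpNorm (fun x ↦ s' j k x - s j k x) 2 W.μ₃ ≤ δ) : W.Approx f t s (ε + δ) := by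
  obtain ⟨g, hg, h1, h2, h3⟩ := hA
  refine ⟨g, hg, fun j ↦ ?_, ?_, fun j k ↦ ?_⟩
  · have : (fun x ↦ g j x - f j x) = (fun x ↦ g j x - f' j x) + fun x ↦ f' j x - f j x := by
      funext x; simp only [Pi.add_apply]; ring
    rw [this]
    exact (eLpNorm_add_le (aestronglyMeasurable_volW ((hg j).continuous.aestronglyMeasurable.sub (hf' j)))
      (aestronglyMeasurable_volW ((hf' j).sub (hf j))) one_le_two).trans (add_le_add (h1 j) (df j))
  · have : (fun x ↦ W.formalAdjoint g x - t x) = (fun x ↦ W.formalAdjoint g x - t' x) + fun x ↦ t' x - t x := by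
      funext x; simp only [Pi.add_apply]; ring
    rw [this]
    exact (eLpNorm_add_le (aestronglyMeasurable_volW ((GraphData.continuous_formalAdjoint h₂ hg).aestronglyMeasurable.sub ht'))
      (aestronglyMeasurable_volW (ht'.sub ht)) one_le_two).trans (add_le_add h2 dt)
  · have : (fun x ↦ (dbar (Pi.single j 1) (g k) x - dbar (Pi.single k 1) (g j) x) - s j k x) =
        (fun x ↦ (dbar (Pi.single j 1) (g k) x - dbar (Pi.single k 1) (g j) x) - s' j k x) + fun x ↦ s' j k x - s j k x := by
      funext x; simp only [Pi.add_apply]; ring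
    rw [this]
    exact (eLpNorm_add_le (aestronglyMeasurable_volW (((((hg k).dbar _).continuous.sub ((hg j).dbar _).continuous)).aestronglyMeasurable.sub (hs' j k)))
      (aestronglyMeasurable_volW ((hs' j k).sub (hs j k))) one_le_two).trans (add_le_add (h3 j k) (ds j k))

/-! ### Lemma 4.1.3: the three approximation steps -/

namespace GraphData

variable {e : OpenPartialHomeomorph D (ι → ℂ)} {K : Set D}

/-- A constant times a sequence tending to `0` tends to `0` (in `ℝ≥0∞`, constant finite). [folklore] -/
theorem tendsto_const_mul_zero {a : ℝ≥0∞} (ha : a ≠ ⊤) {u : ℕ → ℝ≥0∞} (hu : Tendsto u atTop (𝓝 0)) :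
    Tendsto (fun n ↦ a * u n) atTop (𝓝 0) := by
  have := ENNReal.Tendsto.const_mul hu (Or.inr ha)
  rwa [mul_zero] at this

/-- **Step 3 (Friedrichs): graph data supported in a compact subset of one flat chart is approximable
by test forms** (mollification in the chart with a bump sequence, the commutation of
`WirtingerMollification` and the `L²`-convergence of mollifiers). [cite: HormanderSCV1973, Lemma 4.1.3 (proof, p. 80–81)] -/
theorem approx_of_chartSupported (h : W.GraphData f t s) (h₂ : ContMDiff 𝓘(ℝ, ι → ℂ) 𝓘(ℝ, ℝ) ∞ W.φ₂)
    (he : ⇑e = D.proj) (hK : IsCompact K) (hKe : K ⊆ e.source)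
    (hf0 : ∀ j x, x ∉ K → f j x = 0) (ht0 : ∀ x ∉ K, t x = 0) (hs0 : ∀ j k x, x ∉ K → s j k x = 0)
    (hε : 0 < ε) : W.Approx f t s ε := by
  obtain ⟨hK'c, hK'e⟩ := isCompact_image (e := e) hK hKe
  obtain ⟨r, hr0, hr⟩ := hK'c.exists_cthickening_subset_open e.open_target hK'e
  obtain ⟨hKDc, hKDe, hKKD⟩ := isCompact_symm_image_cthickening hK hKe hr
  have hK₁c : IsCompact (Metric.cthickening r (e '' K)) := hK'c.cthickening
  -- weight bounds on `KD`
  obtain ⟨M₁, -, hM₁⟩ := exists_forall_le_of_isCompact hKDc (Real.continuous_exp.comp W.continuous₁.neg)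
  obtain ⟨M₂, -, hM₂⟩ := exists_forall_le_of_isCompact hKDc (Real.continuous_exp.comp W.continuous₂.neg)
  obtain ⟨M₃, -, hM₃⟩ := exists_forall_le_of_isCompact hKDc (Real.continuous_exp.comp W.continuous₃.neg)
  -- multiplier bounds on `cthickening r (e K)`
  obtain ⟨CE, -, hCE⟩ := exists_eLpNorm_rep_mul_le (e := e)
    (continuous_ofReal.comp (Real.continuous_exp.comp (W.continuous₁.sub W.continuous₂))) hK₁c hr
  choose Cd hCd0 hCd using fun j ↦ exists_eLpNorm_rep_mul_le (e := e)
    (contMDiff_del (contMDiff_ofReal h₂) (Pi.single j 1)).continuous hK₁c hr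
  -- the Euclidean data
  have hdiv0 : ∀ x ∉ K, W.divDatum f t x = 0 := fun x hx ↦ divDatum_eq_zero hf0 ht0 hx
  have hF : ∀ j, MemLp (rep e (f j)) 2 volume := fun j ↦ memLp_rep he W.continuous₂ hK hKe (hf0 j) (h.memLp_f j)
  have hS : ∀ j k, MemLp (rep e (s j k)) 2 volume := fun j k ↦ memLp_rep he W.continuous₃ hK hKe (hs0 j k) (h.memLp_s j k)
  have hH : MemLp (rep e (W.divDatum f t)) 2 volume :=
    memLp_rep he W.continuous₁ hK hKe hdiv0 (h.memLp_divDatum h₂ hK hf0 ht0)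
  -- a bump sequence and the flat `L²`-limits
  obtain ⟨β, hβ, -⟩ := FunctionSpaces.exists_contDiffBump_seq (E := ι → ℂ)
  have Lf : ∀ j, Tendsto (fun n ↦ eLpNorm (fun z ↦ ((β n).normed volume ⋆[lsmul ℝ ℝ, volume] rep e (f j)) z - rep e (f j) z)
      2 volume) atTop (𝓝 0) := fun j ↦
    FunctionSpaces.tendsto_eLpNorm_normed_convolution_sub_self hβ one_le_two ENNReal.ofNat_ne_top (hF j)
  have Ls : ∀ j k, Tendsto (fun n ↦ eLpNorm (fun z ↦ ((β n).normed volume ⋆[lsmul ℝ ℝ, volume] rep e (s j k)) z - rep e (s j k) z)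
      2 volume) atTop (𝓝 0) := fun j k ↦
    FunctionSpaces.tendsto_eLpNorm_normed_convolution_sub_self hβ one_le_two ENNReal.ofNat_ne_top (hS j k)
  have Lh : Tendsto (fun n ↦ eLpNorm (fun z ↦ ((β n).normed volume ⋆[lsmul ℝ ℝ, volume] rep e (W.divDatum f t)) z -
      rep e (W.divDatum f t) z) 2 volume) atTop (𝓝 0) :=
    FunctionSpaces.tendsto_eLpNorm_normed_convolution_sub_self hβ one_le_two ENNReal.ofNat_ne_top hH
  have hMtop : ∀ M : ℝ, ENNReal.ofReal M ^ (1 / 2 : ℝ) ≠ ⊤ := fun M ↦ ENNReal.rpow_ne_top_of_nonneg (by norm_num) ENNReal.ofReal_ne_top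
  -- the total bounds tend to `0`
  have Tf : ∀ j, Tendsto (fun n ↦ ENNReal.ofReal M₂ ^ (1 / 2 : ℝ) *
      eLpNorm (fun z ↦ ((β n).normed volume ⋆[lsmul ℝ ℝ, volume] rep e (f j)) z - rep e (f j) z) 2 volume) atTop (𝓝 0) :=
    fun j ↦ tendsto_const_mul_zero (hMtop M₂) (Lf j)
  have Ts : ∀ j k, Tendsto (fun n ↦ ENNReal.ofReal M₃ ^ (1 / 2 : ℝ) *
      eLpNorm (fun z ↦ ((β n).normed volume ⋆[lsmul ℝ ℝ, volume] rep e (s j k)) z - rep e (s j k) z) 2 volume) atTop (𝓝 0) :=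
    fun j k ↦ tendsto_const_mul_zero (hMtop M₃) (Ls j k)
  have Tt : Tendsto (fun n ↦ ENNReal.ofReal M₁ ^ (1 / 2 : ℝ) * (ENNReal.ofReal CE *
      (eLpNorm (fun z ↦ ((β n).normed volume ⋆[lsmul ℝ ℝ, volume] rep e (W.divDatum f t)) z - rep e (W.divDatum f t) z) 2 volume +
        ∑ j, ENNReal.ofReal (Cd j) * eLpNorm (fun z ↦ ((β n).normed volume ⋆[lsmul ℝ ℝ, volume] rep e (f j)) z - rep e (f j) z)
          2 volume))) atTop (𝓝 0) := by
    refine tendsto_const_mul_zero (hMtop M₁) (tendsto_const_mul_zero ENNReal.ofReal_ne_top ?_)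
    have := Lh.add (tendsto_finsetSum Finset.univ fun j _ ↦ tendsto_const_mul_zero (a := ENNReal.ofReal (Cd j))
      ENNReal.ofReal_ne_top (Lf j))
    simpa using this
  -- choose the index
  have E1 : ∀ᶠ n in atTop, (β n).rOut < r := (tendsto_order.1 hβ).2 r hr0
  have E2 : ∀ᶠ n in atTop, ∀ j, ENNReal.ofReal M₂ ^ (1 / 2 : ℝ) *
      eLpNorm (fun z ↦ ((β n).normed volume ⋆[lsmul ℝ ℝ, volume] rep e (f j)) z - rep e (f j) z) 2 volume ≤ ε :=
    eventually_all.2 fun j ↦ ENNReal.tendsto_nhds_zero.1 (Tf j) ε hε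
  have E3 : ∀ᶠ n in atTop, ∀ j k, ENNReal.ofReal M₃ ^ (1 / 2 : ℝ) *
      eLpNorm (fun z ↦ ((β n).normed volume ⋆[lsmul ℝ ℝ, volume] rep e (s j k)) z - rep e (s j k) z) 2 volume ≤ ε :=
    eventually_all.2 fun j ↦ eventually_all.2 fun k ↦ ENNReal.tendsto_nhds_zero.1 (Ts j k) ε hε
  have E4 := ENNReal.tendsto_nhds_zero.1 Tt ε hε
  obtain ⟨n, hn1, hn2, hn3, hn4⟩ := (E1.and (E2.and (E3.and E4))).exists
  -- the kernel
  have hρ : ContDiff ℝ ∞ ((β n).normed volume) := (β n).contDiff_normed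
  have hρc : HasCompactSupport ((β n).normed volume) := (β n).hasCompactSupport_normed
  have hρr : tsupport ((β n).normed volume) ⊆ Metric.closedBall 0 r := by
    rw [(β n).tsupport_normed_eq]; exact Metric.closedBall_subset_closedBall hn1.le
  refine ⟨mollForm e ((β n).normed volume) f,
    fun j ↦ (isTest_mollForm he hK hKe hr hρ hρc hρr W.continuous₂ hf0 h.memLp_f j).1, fun j ↦ ?_, ?_, fun j k ↦ ?_⟩
  · exact (eLpNorm_mollForm_sub_le he hK hKe hr hρ hρc hρr hf0 W.continuous₂ h.aestronglyMeasurable_f h.memLp_f hM₂ j).trans (hn2 j)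
  · exact (h.eLpNorm_formalAdjoint_mollForm_sub_le h₂ he hK hKe hr hρ hρc hρr hf0 ht0 hM₁ hCE hCd).trans hn4
  · exact (h.eLpNorm_dbar_mollForm_sub_le he hK hKe hr hρ hρc hρr hf0 hs0 hM₃ j k).trans (hn3 j k)

/-- `cutT χ f t` vanishes off the support of `χ`. [folklore] -/
theorem cutT_eq_zero {χ : D → ℂ} {x : D} (hx : x ∉ tsupport χ) : W.cutT χ f t x = 0 := by
  rw [cutT, image_eq_zero_of_notMem_tsupport hx, Finset.sum_eq_zero fun j _ ↦ by
    rw [notMem_support.1 fun h ↦ hx (support_del_subset _ χ h), zero_mul]]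
  ring

/-- `cutS χ f s j k` vanishes off the support of `χ`. [folklore] -/
theorem cutS_eq_zero {χ : D → ℂ} {x : D} (hx : x ∉ tsupport χ) (j k : ι) : cutS χ f s j k x = 0 := by
  rw [cutS, image_eq_zero_of_notMem_tsupport hx, notMem_support.1 fun h ↦ hx (support_dbar_subset _ χ h),
    notMem_support.1 fun h ↦ hx (support_dbar_subset _ χ h)]
  ring

omit [DecidableEq ι] in
/-- `∂_v` of a finite sum of test functions. [folklore] -/
theorem del_finset_sum {κ : Type*} {T : Finset κ} {g : κ → D → ℂ} (hg : ∀ i, IsTest (g i)) (v : ι → ℂ) (x : D) :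
    del v (fun y ↦ ∑ i ∈ T, g i y) x = ∑ i ∈ T, del v (g i) x := by
  classical
  induction T using Finset.induction_on with
  | empty => simp [del_const]
  | insert a T ha ih =>
    have : (fun y ↦ ∑ i ∈ insert a T, g i y) = g a + fun y ↦ ∑ i ∈ T, g i y := by
      funext y; rw [Finset.sum_insert ha]; rfl
    rw [this, Finset.sum_insert ha, del_add (differentiableAt_comp_symm_of_contMDiff (hg a).contMDiff x)
      (differentiableAt_comp_symm_of_contMDiff (IsTest.sum fun i _ ↦ hg i).contMDiff x), ih]

omit [DecidableEq ι] in
/-- `∂̄_v` of a finite sum of test functions. [folklore] -/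
theorem dbar_finset_sum {κ : Type*} {T : Finset κ} {g : κ → D → ℂ} (hg : ∀ i, IsTest (g i)) (v : ι → ℂ) (x : D) :
    dbar v (fun y ↦ ∑ i ∈ T, g i y) x = ∑ i ∈ T, dbar v (g i) x := by
  classical
  induction T using Finset.induction_on with
  | empty => simp [dbar_const]
  | insert a T ha ih =>
    have : (fun y ↦ ∑ i ∈ insert a T, g i y) = g a + fun y ↦ ∑ i ∈ T, g i y := by
      funext y; rw [Finset.sum_insert ha]; rfl
    rw [this, Finset.sum_insert ha, dbar_add (differentiableAt_comp_symm_of_contMDiff (hg a).contMDiff x)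
      (differentiableAt_comp_symm_of_contMDiff (IsTest.sum fun i _ ↦ hg i).contMDiff x), ih]

/-- `cutT` is additive in the multiplier over finite families of test functions. [folklore] -/
theorem cutT_finset_sum {κ : Type*} {T : Finset κ} {χ : κ → D → ℂ} (hχ : ∀ i, IsTest (χ i)) (x : D) :
    ∑ i ∈ T, W.cutT (χ i) f t x = W.cutT (fun y ↦ ∑ i ∈ T, χ i y) f t x := by
  simp only [cutT, del_finset_sum hχ, Finset.sum_mul, Finset.mul_sum, Finset.sum_sub_distrib]
  rw [Finset.sum_comm]

/-- `cutS` is additive in the multiplier over finite families of test functions. [folklore] -/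
theorem cutS_finset_sum {κ : Type*} {T : Finset κ} {χ : κ → D → ℂ} (hχ : ∀ i, IsTest (χ i)) (j k : ι) (x : D) :
    ∑ i ∈ T, cutS (χ i) f s j k x = cutS (fun y ↦ ∑ i ∈ T, χ i y) f s j k x := by
  simp only [cutS, dbar_finset_sum hχ, Finset.sum_mul, Finset.sum_add_distrib, Finset.sum_sub_distrib]

/-- **Uniqueness of graph data**: if `Θ f = f` for a test function `Θ`, then the graph data of `Θ f`
agree a.e. with `(t, s)`. [folklore] -/
theorem cutT_ae_eq (h : W.GraphData f t s) {Θ : D → ℂ} (hΘ : IsTest Θ) (hΘf : ∀ j x, Θ x * f j x = f j x) :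
    W.cutT Θ f t =ᵐ[D.vol] t := by
  have h1 := (h.smul hΘ).weakT
  have h1' : HasWeakDelDiv D (fun x j ↦ f j x * (Real.exp (-W.φ₂ x) : ℂ)) (fun x ↦ -W.cutT Θ f t x * (Real.exp (-W.φ₁ x) : ℂ)) :=
    h1.congr_ae (fun j ↦ ae_of_all _ fun x ↦ by simp only [hΘf]) (ae_of_all _ fun _ ↦ rfl)
  filter_upwards [h1'.ae_eq h.weakT] with x hx
  have hE : (Real.exp (-W.φ₁ x) : ℂ) ≠ 0 := ofReal_ne_zero.2 (Real.exp_pos _).ne'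
  have := mul_right_cancel₀ hE hx
  exact neg_injective this

/-- **Uniqueness of graph data, `S`-part.** [folklore] -/
theorem cutS_ae_eq (h : W.GraphData f t s) {Θ : D → ℂ} (hΘ : IsTest Θ) (hΘf : ∀ j x, Θ x * f j x = f j x) (j k : ι) :
    cutS Θ f s j k =ᵐ[D.vol] s j k := by
  have h1 := (h.smul hΘ).weakS
  have h1' : HasWeakDbarForm D (fun x j ↦ f j x) (fun x j k ↦ cutS Θ f s j k x) :=
    h1.congr_ae (fun j ↦ ae_of_all _ fun x ↦ by simp only [hΘf]) (fun j k ↦ ae_of_all _ fun _ ↦ rfl)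
  exact h1'.ae_eq h.weakS j k

/-- **Step 2 (partition of unity): compactly supported graph data is approximable by test forms**
(a smooth partition of unity subordinate to the flat charts splits the data into finitely many
chart-supported pieces; their graph data sum up to graph data of `f`, hence agree a.e. with `(t, s)`).
[cite: HormanderSCV1973, Lemma 4.1.3 (proof, p. 80–81)] -/
theorem approx_of_isCompact (h : W.GraphData f t s) (h₂ : ContMDiff 𝓘(ℝ, ι → ℂ) 𝓘(ℝ, ℝ) ∞ W.φ₂)
    (hK : IsCompact K) (hf0 : ∀ j x, x ∉ K → f j x = 0) (hε : 0 < ε) : W.Approx f t s ε := by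
  classical
  -- a smooth partition of unity subordinate to the flat chart sources, and a cut-off `= 1` on `K`
  obtain ⟨ρ, hρ⟩ := SmoothPartitionOfUnity.exists_isSubordinate 𝓘(ℝ, ι → ℂ) isClosed_univ
    (fun x : D ↦ (D.chart x).source) (fun x ↦ (D.chart x).open_source)
    (fun x _ ↦ mem_iUnion.2 ⟨x, D.mem_chart_source x⟩)
  obtain ⟨θ, hθs, hθc, -, hθ1⟩ := exists_cutoff_eq_one hK
  have hθ1' : ∀ x ∈ K, θ x = 1 := fun x hx ↦ (hθ1.self_of_nhdsSet) x hx
  have hfin : {i | (support (ρ i) ∩ tsupport θ).Nonempty}.Finite :=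
    ρ.locallyFinite.finite_nonempty_inter_compact hθc
  set T : Finset D := hfin.toFinset with hT
  set χ : D → D → ℂ := fun i x ↦ ((θ x * ρ i x : ℝ) : ℂ) with hχdef
  have hχ : ∀ i, IsTest (χ i) := fun i ↦ IsTest.ofReal (hθs.mul (ρ i).contMDiff) hθc.mul_right
  have hχsub : ∀ i, tsupport (χ i) ⊆ (D.chart i).source := fun i ↦
    ((tsupport_comp_subset ofReal_zero _).trans (tsupport_mul_subset_right (f := θ) (g := fun x ↦ ρ i x))).trans (hρ i)
  -- `∑_{i ∈ T} χ_i = 1` on `K`, hence `∑ χ_i f = f`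
  have hsum1 : ∀ x ∈ K, ∑ i ∈ T, χ i x = 1 := fun x hx ↦ by
    have hxθ : x ∈ tsupport θ := subset_tsupport _ (by rw [mem_support, hθ1' x hx]; exact one_ne_zero)
    have h1 : ∑ᶠ i, ρ i x = 1 := ρ.sum_eq_one (mem_univ x)
    have hsub : (support fun i ↦ ρ i x) ⊆ (T : Set D) := fun i hi ↦ by
      rw [hT, Finite.coe_toFinset]; exact ⟨x, hi, hxθ⟩
    rw [finsum_eq_sum_of_support_subset _ hsub] at h1
    simp only [hχdef, hθ1' x hx, one_mul]
    rw [← ofReal_sum, h1, ofReal_one]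
  have hΘf : ∀ j x, (∑ i ∈ T, χ i x) * f j x = f j x := fun j x ↦ by
    by_cases hx : x ∈ K
    · rw [hsum1 x hx, one_mul]
    · rw [hf0 j x hx, mul_zero]
  -- the pieces
  have hP : ∀ i, W.GraphData (fun j x ↦ χ i x * f j x) (W.cutT (χ i) f t) (cutS (χ i) f s) := fun i ↦ h.smul (hχ i)
  have hA : ∀ i ∈ T, W.Approx (fun j x ↦ χ i x * f j x) (W.cutT (χ i) f t) (cutS (χ i) f s) (ε / T.card) := fun i _ ↦
    (hP i).approx_of_chartSupported h₂ (D.coe_chart i) (hχ i).hasCompactSupport (hχsub i)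
      (fun j x hx ↦ by rw [image_eq_zero_of_notMem_tsupport hx, zero_mul]) (fun x hx ↦ cutT_eq_zero hx)
      (fun j k x hx ↦ cutS_eq_zero hx j k) (ENNReal.div_pos hε.ne' (ENNReal.natCast_ne_top _))
  have hSum := Approx.finset_sum h₂ T hA (fun i j ↦ (hP i).aestronglyMeasurable_f j) (fun i ↦ (hP i).aestronglyMeasurable_t)
    (fun i j k ↦ (hP i).aestronglyMeasurable_s j k)
  -- identify the summed data
  have hΘ : IsTest fun y ↦ ∑ i ∈ T, χ i y := IsTest.sum fun i _ ↦ hχ i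
  have ef : (fun j x ↦ ∑ i ∈ T, χ i x * f j x) = f := by
    funext j x; rw [← Finset.sum_mul, hΘf]
  have et : (fun x ↦ ∑ i ∈ T, W.cutT (χ i) f t x) = W.cutT (fun y ↦ ∑ i ∈ T, χ i y) f t := by
    funext x; exact cutT_finset_sum hχ x
  have es : (fun j k x ↦ ∑ i ∈ T, cutS (χ i) f s j k x) = cutS (fun y ↦ ∑ i ∈ T, χ i y) f s := by
    funext j k x; exact cutS_finset_sum hχ j k x
  rw [ef, et, es] at hSum
  refine (hSum.congr_ae (fun j ↦ EventuallyEq.rfl) (h.cutT_ae_eq hΘ hΘf) (h.cutS_ae_eq hΘ hΘf)).mono ?_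
  -- `∑_{i ∈ T} ε / |T| ≤ ε`
  rw [Finset.sum_const, nsmul_eq_mul]
  rcases eq_or_ne T.card 0 with hc | hc
  · simp [hc]
  · rw [ENNReal.mul_div_cancel (Nat.cast_ne_zero.2 hc) (ENNReal.natCast_ne_top _)]

/-- **Lemma 4.1.3 (Hörmander): graph-norm density of test forms.** Let `(f, t, s)` be graph data for
the weights `(φ₁, φ₂, φ₃)` (`φ₂` smooth) and let `η_ν ∈ C_c^∞(D; [0,1])` be cut-offs, eventually `1`
near every point, satisfying (4.1.6): `∑_k |∂̄_k η_ν|² ≤ e^{φ₂-φ₁}` and `≤ e^{φ₃-φ₂}`. Then for every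
`ε > 0` there is a test form `g` with `‖g - f‖_{φ₂}, ‖ϑ g - t‖_{φ₁}, ‖S g - s‖_{φ₃} ≤ ε`.
[cite: HormanderSCV1973, Lemma 4.1.3] -/
theorem approx (h : W.GraphData f t s) (h₂ : ContMDiff 𝓘(ℝ, ι → ℂ) 𝓘(ℝ, ℝ) ∞ W.φ₂) {η : ℕ → D → ℝ}
    (hηs : ∀ ν, ContMDiff 𝓘(ℝ, ι → ℂ) 𝓘(ℝ, ℝ) ∞ (η ν)) (hηc : ∀ ν, HasCompactSupport (η ν))
    (hη01 : ∀ ν x, η ν x ∈ Icc (0 : ℝ) 1) (hη1 : ∀ x, ∀ᶠ ν in atTop, ∀ᶠ y in 𝓝 x, η ν y = 1)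
    (h12 : ∀ ν x, ∑ k, ‖dbar (Pi.single k 1) (fun y ↦ (η ν y : ℂ)) x‖ ^ 2 ≤ Real.exp (W.φ₂ x - W.φ₁ x))
    (h23 : ∀ ν x, ∑ k, ‖dbar (Pi.single k 1) (fun y ↦ (η ν y : ℂ)) x‖ ^ 2 ≤ Real.exp (W.φ₃ x - W.φ₂ x))
    (hε : 0 < ε) : W.Approx f t s ε := by
  have hε2 : 0 < ε / 2 := ENNReal.half_pos hε.ne'
  -- Step 1: cut-off
  have E1 : ∀ᶠ ν in atTop, ∀ j, eLpNorm (fun x ↦ (η ν x : ℂ) * f j x - f j x) 2 W.μ₂ ≤ ε / 2 :=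
    eventually_all.2 fun j ↦ ENNReal.tendsto_nhds_zero.1 (h.tendsto_cutoff_f hηs hη01 hη1 j) _ hε2
  have E2 : ∀ᶠ ν in atTop, eLpNorm (fun x ↦ W.cutT (fun y ↦ (η ν y : ℂ)) f t x - t x) 2 W.μ₁ ≤ ε / 2 :=
    ENNReal.tendsto_nhds_zero.1 (h.tendsto_cutoff_t hηs hηc hη01 hη1 h12) _ hε2
  have E3 : ∀ᶠ ν in atTop, ∀ j k, eLpNorm (fun x ↦ cutS (fun y ↦ (η ν y : ℂ)) f s j k x - s j k x) 2 W.μ₃ ≤ ε / 2 :=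
    eventually_all.2 fun j ↦ eventually_all.2 fun k ↦ ENNReal.tendsto_nhds_zero.1 (h.tendsto_cutoff_s hηs hηc hη01 hη1 h23 j k) _ hε2
  obtain ⟨ν, hν1, hν2, hν3⟩ := (E1.and (E2.and E3)).exists
  have hηt : IsTest fun y ↦ (η ν y : ℂ) := IsTest.ofReal (hηs ν) (hηc ν)
  -- Step 2–3 for the cut-off data
  have h' := h.smul hηt
  have hA : W.Approx (fun j x ↦ (η ν x : ℂ) * f j x) (W.cutT (fun y ↦ (η ν y : ℂ)) f t) (cutS (fun y ↦ (η ν y : ℂ)) f s) (ε / 2) :=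
    h'.approx_of_isCompact h₂ hηt.hasCompactSupport (fun j x hx ↦ by rw [image_eq_zero_of_notMem_tsupport hx, zero_mul]) hε2
  have := hA.of_near h₂ h.aestronglyMeasurable_f h.aestronglyMeasurable_t h.aestronglyMeasurable_s h'.aestronglyMeasurable_f
    h'.aestronglyMeasurable_t h'.aestronglyMeasurable_s hν1 hν2 hν3
  rwa [ENNReal.add_halves] at this

end GraphData

end Approx

/-! ### From test forms to `D_{T*} ∩ F`: tools -/

section ClosureTools

/-- **Weighted `L²`-norm as an integral**: `∫ |u|² e^{-φ'} d vol = ‖u‖²_{L²(e^{-φ'} vol)}`. [folklore] -/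
theorem integral_norm_sq_mul_exp_eq {φ' : D → ℝ} (hφ' : Continuous φ') {u : D → ℂ} (hu : MemLp u 2 (D.volW φ')) :
    ∫ x, ‖u x‖ ^ 2 * Real.exp (-φ' x) ∂D.vol = (eLpNorm u 2 (D.volW φ')).toReal ^ 2 := by
  have h1 : ∫ x, ‖u x‖ ^ 2 * Real.exp (-φ' x) ∂D.vol = ∫ x, ‖u x‖ ^ 2 ∂D.volW φ' := by
    rw [integral_volW hφ']
    exact integral_congr_ae (ae_of_all _ fun x ↦ by simp only [smul_eq_mul]; ring)
  rw [h1, integral_eq_lintegral_of_nonneg_ae (ae_of_all _ fun x ↦ by positivity)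
    ((continuous_pow 2).comp_aestronglyMeasurable hu.1.norm)]
  have h2 : ∫⁻ x, ENNReal.ofReal (‖u x‖ ^ 2) ∂D.volW φ' = ∫⁻ x, ‖u x‖ₑ ^ 2 ∂D.volW φ' :=
    lintegral_congr fun x ↦ by rw [ENNReal.ofReal_pow (norm_nonneg _), ofReal_norm]
  have h3 : ∫⁻ x, ‖u x‖ₑ ^ 2 ∂D.volW φ' = eLpNorm u 2 (D.volW φ') ^ 2 := by
    rw [FluidPDE.eLpNorm_two_eq_rpow, ← ENNReal.rpow_natCast, ← ENNReal.rpow_mul]; norm_num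
  rw [h2, h3, ENNReal.toReal_pow]

/-- **Continuity of the `L²`-norm along a convergent sequence**: if `‖u_n - v‖ → 0` then `‖u_n‖ → ‖v‖`
(in `ℝ≥0∞`). [folklore] -/
theorem tendsto_eLpNorm_of_tendsto_sub {α : Type*} [MeasurableSpace α] {μ : Measure α} {u : ℕ → α → ℂ} {v : α → ℂ}
    (hu : ∀ n, AEStronglyMeasurable (u n) μ) (hv : AEStronglyMeasurable v μ) (hv2 : eLpNorm v 2 μ ≠ ⊤)
    (h : Tendsto (fun n ↦ eLpNorm (fun x ↦ u n x - v x) 2 μ) atTop (𝓝 0)) :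
    Tendsto (fun n ↦ eLpNorm (u n) 2 μ) atTop (𝓝 (eLpNorm v 2 μ)) := by
  have hup : ∀ n, eLpNorm (u n) 2 μ ≤ eLpNorm (fun x ↦ u n x - v x) 2 μ + eLpNorm v 2 μ := fun n ↦ by
    have : u n = (fun x ↦ u n x - v x) + v := by funext x; simp
    conv_lhs => rw [this]
    exact eLpNorm_add_le ((hu n).sub hv) hv one_le_two
  have hlow : ∀ n, eLpNorm v 2 μ - eLpNorm (fun x ↦ u n x - v x) 2 μ ≤ eLpNorm (u n) 2 μ := fun n ↦ by
    rw [tsub_le_iff_right]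
    have h1 : v = (fun x ↦ v x - u n x) + u n := by funext x; simp
    have h2 : (fun x ↦ v x - u n x) = -fun x ↦ u n x - v x := by funext x; simp
    calc eLpNorm v 2 μ = eLpNorm ((fun x ↦ v x - u n x) + u n) 2 μ := by rw [← h1]
      _ ≤ eLpNorm (fun x ↦ v x - u n x) 2 μ + eLpNorm (u n) 2 μ := eLpNorm_add_le (hv.sub (hu n)) (hu n) one_le_two
      _ = eLpNorm (u n) 2 μ + eLpNorm (fun x ↦ u n x - v x) 2 μ := by rw [h2, eLpNorm_neg, add_comm]
  have h1 : Tendsto (fun n ↦ eLpNorm (fun x ↦ u n x - v x) 2 μ + eLpNorm v 2 μ) atTop (𝓝 (eLpNorm v 2 μ)) := by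
    have := h.add (tendsto_const_nhds (x := eLpNorm v 2 μ))
    rwa [zero_add] at this
  have h2 : Tendsto (fun n ↦ eLpNorm v 2 μ - eLpNorm (fun x ↦ u n x - v x) 2 μ) atTop (𝓝 (eLpNorm v 2 μ)) := by
    have := ENNReal.Tendsto.sub (tendsto_const_nhds (x := eLpNorm v 2 μ)) h (Or.inl hv2)
    rwa [tsub_zero] at this
  exact tendsto_of_tendsto_of_tendsto_of_le_of_le h2 h1 hlow hup

/-- **An a.e.-convergent subsequence for finitely many components**: if `u_n^j → v^j` in `L²(μ)` for
every `j`, a subsequence converges a.e. in every component simultaneously. [folklore] -/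
theorem exists_seq_tendsto_ae {μ : Measure D} {u : ℕ → ι → D → ℂ} {v : ι → D → ℂ}
    (hu : ∀ n j, AEStronglyMeasurable (u n j) μ) (hv : ∀ j, AEStronglyMeasurable (v j) μ)
    (h : ∀ j, Tendsto (fun n ↦ eLpNorm (fun x ↦ u n j x - v j x) 2 μ) atTop (𝓝 0)) :
    ∃ ns : ℕ → ℕ, StrictMono ns ∧ ∀ᵐ x ∂μ, ∀ j, Tendsto (fun i ↦ u (ns i) j x) atTop (𝓝 (v j x)) := by
  -- the `ℂ^ι`-valued functions
  set U : ℕ → D → (ι → ℂ) := fun n x j ↦ u n j x with hU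
  set V : D → (ι → ℂ) := fun x j ↦ v j x with hV
  have hUm : ∀ n, AEStronglyMeasurable (U n) μ := fun n ↦
    (aestronglyMeasurable_iff_aemeasurable).2 (aemeasurable_pi_iff.2 fun j ↦ (hu n j).aemeasurable)
  have hVm : AEStronglyMeasurable V μ := (aestronglyMeasurable_iff_aemeasurable).2 (aemeasurable_pi_iff.2 fun j ↦ (hv j).aemeasurable)
  have hle : ∀ n, eLpNorm (U n - V) 2 μ ≤ ∑ j, eLpNorm (fun x ↦ u n j x - v j x) 2 μ := fun n ↦ by
    have h1 : eLpNorm (U n - V) 2 μ ≤ eLpNorm (fun x ↦ ∑ j, ‖u n j x - v j x‖) 2 μ := by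
      refine eLpNorm_mono_real fun x ↦ (pi_norm_le_iff_of_nonneg (Finset.sum_nonneg fun j _ ↦ norm_nonneg _)).2 fun j ↦ ?_
      exact Finset.single_le_sum (f := fun j ↦ ‖u n j x - v j x‖) (fun j _ ↦ norm_nonneg _) (Finset.mem_univ j)
    refine h1.trans ?_
    have h2 : (fun x ↦ ∑ j, ‖u n j x - v j x‖) = ∑ j, fun x ↦ ‖u n j x - v j x‖ := by
      funext x; simp only [Finset.sum_apply]
    rw [h2]
    refine (eLpNorm_sum_le (fun j _ ↦ ((hu n j).sub (hv j)).norm) one_le_two).trans (le_of_eq ?_)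
    exact Finset.sum_congr rfl fun j _ ↦ eLpNorm_norm _
  have hlim : Tendsto (fun n ↦ eLpNorm (U n - V) 2 μ) atTop (𝓝 0) := by
    have hs : Tendsto (fun n ↦ ∑ j, eLpNorm (fun x ↦ u n j x - v j x) 2 μ) atTop (𝓝 0) := by
      have := tendsto_finsetSum Finset.univ fun j _ ↦ h j
      simpa using this
    exact tendsto_of_tendsto_of_tendsto_of_le_of_le tendsto_const_nhds hs (fun _ ↦ zero_le) hle
  obtain ⟨ns, hns, hae⟩ := (tendstoInMeasure_of_tendsto_eLpNorm two_ne_zero hUm hVm hlim).exists_seq_tendsto_ae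
  exact ⟨ns, hns, hae.mono fun x hx j ↦ (tendsto_pi_nhds.1 hx) j⟩

end ClosureTools

/-! ### Hörmander's estimate on `D_{T*} ∩ F` -/

section Closure

variable [DecidableEq ι] {φ ψ : D → ℝ} (hφ : ContMDiff 𝓘(ℝ, ι → ℂ) 𝓘(ℝ, ℝ) ∞ φ) (hψ : ContMDiff 𝓘(ℝ, ι → ℂ) 𝓘(ℝ, ℝ) ∞ ψ)

include hφ hψ in
/-- **Hörmander's basic estimate on `D_{T*} ∩ F`** (§4.2, p. 84: «(4.2.9) … hence when `f ∈ D_{T*} ∩ D_S`»,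
in the form used in the proof of Lemma 4.4.1). For the weights `φ₁ = φ - 2ψ`, `φ₂ = φ - ψ`, `φ₃ = φ`
(`hormanderWeights`) with `φ, ψ ∈ C^∞`, a Levi bound `∑ φ_{jk̄} v_j v̄_k ≥ c |v|²`, a continuous
`0 ≤ κ ≤ c - 2|∂ψ|²`, and cut-offs `η_ν ∈ C_c^∞(D; [0,1])`, eventually `1` near every point, with
`∑_k |∂̄_k η_ν|² ≤ e^{ψ}` ((4.2.2)), every `f ∈ D_{T*}` with `S f = 0` weakly satisfies
`∫ κ |f|² e^{-φ} d vol ≤ 2 ‖T* f‖²_{φ₁}` (Lemma 4.1.3 and Fatou along an a.e.-convergent subsequence).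
[cite: HormanderSCV1973, §4.2 (4.2.9) p. 84; Lemma 4.1.3] -/
theorem hormander_estimate_of_mem_F {c : D → ℝ} (hc : Continuous c)
    (hLevi : ∀ (x : D) (v : ι → ℂ), c x * ∑ j, ‖v j‖ ^ 2 ≤
      (∑ j, ∑ k, del (Pi.single j 1) (dbar (Pi.single k 1) (fun z ↦ (φ z : ℂ))) x * v j * conj (v k)).re)
    {κ : D → ℝ} (hκ : Continuous κ) (hκ0 : ∀ x, 0 ≤ κ x)
    (hκc : ∀ x, κ x ≤ c x - 2 * ∑ j, ‖del (Pi.single j 1) (fun y ↦ (ψ y : ℂ)) x‖ ^ 2)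
    {η : ℕ → D → ℝ} (hηs : ∀ ν, ContMDiff 𝓘(ℝ, ι → ℂ) 𝓘(ℝ, ℝ) ∞ (η ν)) (hηc : ∀ ν, HasCompactSupport (η ν))
    (hη01 : ∀ ν x, η ν x ∈ Icc (0 : ℝ) 1) (hη1 : ∀ x, ∀ᶠ ν in atTop, ∀ᶠ y in 𝓝 x, η ν y = 1)
    (hηψ : ∀ ν x, ∑ k, ‖dbar (Pi.single k 1) (fun y ↦ (η ν y : ℂ)) x‖ ^ 2 ≤ Real.exp (ψ x)) :
    ∀ (f : (hormanderWeights φ ψ hφ.continuous hψ.continuous).T†.domain),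
      (f : (hormanderWeights φ ψ hφ.continuous hψ.continuous).H2) ∈ (hormanderWeights φ ψ hφ.continuous hψ.continuous).F →
    Integrable (fun x ↦ κ x * (∑ j, ‖((f : (hormanderWeights φ ψ hφ.continuous hψ.continuous).H2) j : D → ℂ) x‖ ^ 2) *
      Real.exp (-φ x)) D.vol ∧
    ∫ x, κ x * (∑ j, ‖((f : (hormanderWeights φ ψ hφ.continuous hψ.continuous).H2) j : D → ℂ) x‖ ^ 2) * Real.exp (-φ x) ∂D.vol ≤
      2 * ‖(hormanderWeights φ ψ hφ.continuous hψ.continuous).T† f‖ ^ 2 := by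
  set W := hormanderWeights φ ψ hφ.continuous hψ.continuous with hW
  intro f hF
  -- the weights
  have e12 : ∀ x, W.φ₂ x - W.φ₁ x = ψ x := fun x ↦ by simp only [hW, hormanderWeights_φ₁, hormanderWeights_φ₂]; ring
  have e23 : ∀ x, W.φ₃ x - W.φ₂ x = ψ x := fun x ↦ by
    simp only [hW, hormanderWeights_φ₂, hormanderWeights_φ₃]; ring
  have e1 : ∀ x, W.φ₁ x = φ x - 2 * ψ x := fun x ↦ by simp only [hW, hormanderWeights_φ₁]
  have e3 : ∀ x, W.φ₃ x = φ x := fun x ↦ by simp only [hW, hormanderWeights_φ₃]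
  have hφ₁ : ContMDiff 𝓘(ℝ, ι → ℂ) 𝓘(ℝ, ℝ) ∞ W.φ₁ := hφ.sub (contMDiff_const.mul hψ)
  have hφ₂ : ContMDiff 𝓘(ℝ, ι → ℂ) 𝓘(ℝ, ℝ) ∞ W.φ₂ := hφ.sub hψ
  -- graph data and approximating test forms `g ν` with errors `≤ 1/ν`
  set fF : ι → D → ℂ := fun j x ↦ ((f : W.H2) j : D → ℂ) x with hfF
  set tT : D → ℂ := fun x ↦ (W.T† f : D → ℂ) x with htT
  have hGD : W.GraphData fF tT (fun _ _ _ ↦ 0) := graphData_of_mem_adjoint_of_mem_F f hF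
  have hA : ∀ ν : ℕ, W.Approx fF tT (fun _ _ _ ↦ 0) ((ν : ℝ≥0∞)⁻¹) := fun ν ↦
    hGD.approx hφ₂ hηs hηc hη01 hη1 (fun ν x ↦ by rw [e12]; exact hηψ ν x) (fun ν x ↦ by rw [e23]; exact hηψ ν x)
      (ENNReal.inv_pos.2 (ENNReal.natCast_ne_top ν))
  choose g hg hgf hgt hgs using hA
  have hinv : Tendsto (fun ν : ℕ ↦ (ν : ℝ≥0∞)⁻¹) atTop (𝓝 0) := ENNReal.tendsto_inv_nat_nhds_zero
  have sq : ∀ {e : ℕ → ℝ≥0∞}, (∀ ν, e ν ≤ (ν : ℝ≥0∞)⁻¹) → Tendsto e atTop (𝓝 0) := fun he ↦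
    tendsto_of_tendsto_of_tendsto_of_le_of_le tendsto_const_nhds hinv (fun _ ↦ zero_le) he
  -- (1) the estimate for the test forms, with `κ`
  have hψC : ContMDiff 𝓘(ℝ, ι → ℂ) 𝓘(ℝ, ℂ) ∞ fun y ↦ (ψ y : ℂ) := contMDiff_ofReal hψ
  have cΨ : Continuous fun x ↦ ∑ j, ‖del (Pi.single j 1) (fun y ↦ (ψ y : ℂ)) x‖ ^ 2 :=
    continuous_finsetSum _ fun j _ ↦ ((contMDiff_del hψC _).continuous.norm).pow 2
  have cG : ∀ ν, Continuous fun x ↦ ∑ j, ‖g ν j x‖ ^ 2 := fun ν ↦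
    continuous_finsetSum _ fun j _ ↦ ((hg ν j).continuous.norm).pow 2
  have cE : Continuous fun x ↦ Real.exp (-φ x) := Real.continuous_exp.comp hφ.continuous.neg
  have G0 : ∀ ν x, x ∉ ⋃ j, tsupport (g ν j) → ∑ j, ‖g ν j x‖ ^ 2 = 0 := fun ν x hx ↦
    Finset.sum_eq_zero fun j _ ↦ by
      obtain ⟨h0, -, -⟩ := eq_zero_of_notMem_iUnion_tsupport hx j (Pi.single j 1); rw [h0]; simp
  have Iκ : ∀ ν, Integrable (fun x ↦ κ x * (∑ j, ‖g ν j x‖ ^ 2) * Real.exp (-φ x)) D.vol := fun ν ↦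
    integrable_of_eq_zero (hg ν) ((hκ.mul (cG ν)).mul cE) fun x hx ↦ by rw [G0 ν x hx]; simp
  have Ic : ∀ ν, Integrable (fun x ↦ (c x - 2 * ∑ j, ‖del (Pi.single j 1) (fun y ↦ (ψ y : ℂ)) x‖ ^ 2) *
      (∑ j, ‖g ν j x‖ ^ 2) * Real.exp (-φ x)) D.vol := fun ν ↦
    integrable_of_eq_zero (hg ν) (((hc.sub (continuous_const.mul cΨ)).mul (cG ν)).mul cE) fun x hx ↦ by rw [G0 ν x hx]; simp
  have hest : ∀ ν, ∫ x, κ x * (∑ j, ‖g ν j x‖ ^ 2) * Real.exp (-φ x) ∂D.vol ≤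
      2 * ∫ x, ‖W.formalAdjoint (g ν) x‖ ^ 2 * Real.exp (-(φ x - 2 * ψ x)) ∂D.vol +
        (1 / 2) * ∑ j, ∑ k, ∫ x, ‖dbar (Pi.single k 1) (g ν j) x - dbar (Pi.single j 1) (g ν k) x‖ ^ 2 * Real.exp (-φ x) ∂D.vol :=
    fun ν ↦ (integral_mono (Iκ ν) (Ic ν) fun x ↦ by
      have : 0 ≤ (∑ j, ‖g ν j x‖ ^ 2) * Real.exp (-φ x) := by positivity
      calc κ x * (∑ j, ‖g ν j x‖ ^ 2) * Real.exp (-φ x) = κ x * ((∑ j, ‖g ν j x‖ ^ 2) * Real.exp (-φ x)) := by ring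
        _ ≤ (c x - 2 * ∑ j, ‖del (Pi.single j 1) (fun y ↦ (ψ y : ℂ)) x‖ ^ 2) * ((∑ j, ‖g ν j x‖ ^ 2) * Real.exp (-φ x)) :=
            mul_le_mul_of_nonneg_right (hκc x) this
        _ = _ := by ring).trans (hormander_estimate_test hφ hψ (hg ν) hc hLevi)
  -- (2) the right-hand side in terms of `L²`-norms
  have hA_eq : ∀ ν, ∫ x, ‖W.formalAdjoint (g ν) x‖ ^ 2 * Real.exp (-(φ x - 2 * ψ x)) ∂D.vol =
      (eLpNorm (W.formalAdjoint (g ν)) 2 W.μ₁).toReal ^ 2 := fun ν ↦ by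
    have := integral_norm_sq_mul_exp_eq W.continuous₁ (W.memLp₁ (isTest_formalAdjoint hφ₁ hφ₂ (hg ν)))
    simpa only [e1] using this
  have hS_eq : ∀ ν j k, ∫ x, ‖dbar (Pi.single k 1) (g ν j) x - dbar (Pi.single j 1) (g ν k) x‖ ^ 2 * Real.exp (-φ x) ∂D.vol =
      (eLpNorm (fun x ↦ dbar (Pi.single j 1) (g ν k) x - dbar (Pi.single k 1) (g ν j) x) 2 W.μ₃).toReal ^ 2 := fun ν j k ↦ by
    have := integral_norm_sq_mul_exp_eq W.continuous₃ (W.memLp₃ (((hg ν k).dbar (Pi.single j 1)).sub' ((hg ν j).dbar (Pi.single k 1))))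
    simp only [e3] at this
    rw [← this]
    exact integral_congr_ae (ae_of_all _ fun x ↦ by dsimp only; rw [norm_sub_rev])
  -- (3) limits of the right-hand side
  have hTm : ∀ ν, AEStronglyMeasurable (W.formalAdjoint (g ν)) W.μ₁ := fun ν ↦ (isTest_formalAdjoint hφ₁ hφ₂ (hg ν)).continuous.aestronglyMeasurable
  have htTm : AEStronglyMeasurable tT W.μ₁ := Lp.aestronglyMeasurable _
  have htT2 : eLpNorm tT 2 W.μ₁ ≠ ⊤ := Lp.eLpNorm_ne_top _
  have LT : Tendsto (fun ν ↦ (eLpNorm (W.formalAdjoint (g ν)) 2 W.μ₁).toReal ^ 2) atTop (𝓝 (‖W.T† f‖ ^ 2)) := by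
    have h1 := tendsto_eLpNorm_of_tendsto_sub hTm htTm htT2 (sq hgt)
    have h2 := ((ENNReal.tendsto_toReal htT2).comp h1).pow 2
    rwa [← Lp.norm_def] at h2
  have LS : ∀ j k, Tendsto (fun ν ↦ (eLpNorm (fun x ↦ dbar (Pi.single j 1) (g ν k) x - dbar (Pi.single k 1) (g ν j) x) 2 W.μ₃).toReal ^ 2)
      atTop (𝓝 0) := fun j k ↦ by
    have h1 : Tendsto (fun ν ↦ eLpNorm (fun x ↦ dbar (Pi.single j 1) (g ν k) x - dbar (Pi.single k 1) (g ν j) x) 2 W.μ₃) atTop (𝓝 0) := by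
      refine sq fun ν ↦ le_of_eq_of_le ?_ (hgs ν j k)
      congr 1; funext x; rw [sub_zero]
    have h2 := ((ENNReal.tendsto_toReal ENNReal.zero_ne_top).comp h1).pow 2
    simpa using h2
  have LR : Tendsto (fun ν ↦ 2 * ∫ x, ‖W.formalAdjoint (g ν) x‖ ^ 2 * Real.exp (-(φ x - 2 * ψ x)) ∂D.vol +
      (1 / 2) * ∑ j, ∑ k, ∫ x, ‖dbar (Pi.single k 1) (g ν j) x - dbar (Pi.single j 1) (g ν k) x‖ ^ 2 * Real.exp (-φ x) ∂D.vol)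
      atTop (𝓝 (2 * ‖W.T† f‖ ^ 2)) := by
    simp_rw [hA_eq, hS_eq]
    have := (LT.const_mul 2).add ((tendsto_finsetSum Finset.univ fun j _ ↦ tendsto_finsetSum Finset.univ fun k _ ↦ LS j k).const_mul (1 / 2))
    simpa using this
  -- (4) an a.e.-convergent subsequence and Fatou
  have hgm : ∀ ν j, AEStronglyMeasurable (g ν j) W.μ₂ := fun ν j ↦ (hg ν j).continuous.aestronglyMeasurable
  have hfm : ∀ j, AEStronglyMeasurable (fF j) W.μ₂ := fun j ↦ Lp.aestronglyMeasurable _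
  obtain ⟨ns, hns, hae⟩ := exists_seq_tendsto_ae hgm hfm fun j ↦ sq fun ν ↦ hgf ν j
  have hae' : ∀ᵐ x ∂D.vol, ∀ j, Tendsto (fun i ↦ g (ns i) j x) atTop (𝓝 (fF j x)) := (ae_volW_iff W.continuous₂).1 hae
  set Gm : ℕ → D → ℝ≥0∞ := fun m x ↦ ENNReal.ofReal (κ x * (∑ j, ‖g (ns m) j x‖ ^ 2) * Real.exp (-φ x)) with hGm
  have hGmeas : ∀ m, AEMeasurable (Gm m) D.vol := fun m ↦
    (ENNReal.measurable_ofReal.comp (((hκ.mul (cG (ns m))).mul cE).measurable)).aemeasurable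
  have hptw : ∀ᵐ x ∂D.vol, Tendsto (fun m ↦ Gm m x) atTop
      (𝓝 (ENNReal.ofReal (κ x * (∑ j, ‖fF j x‖ ^ 2) * Real.exp (-φ x)))) := by
    filter_upwards [hae'] with x hx
    refine (ENNReal.continuous_ofReal.tendsto _).comp ?_
    refine ((tendsto_const_nhds.mul (tendsto_finsetSum Finset.univ fun j _ ↦ ((hx j).norm).pow 2)).mul tendsto_const_nhds)
  have hFatou : ∫⁻ x, ENNReal.ofReal (κ x * (∑ j, ‖fF j x‖ ^ 2) * Real.exp (-φ x)) ∂D.vol ≤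
      liminf (fun m ↦ ∫⁻ x, Gm m x ∂D.vol) atTop := by
    calc ∫⁻ x, ENNReal.ofReal (κ x * (∑ j, ‖fF j x‖ ^ 2) * Real.exp (-φ x)) ∂D.vol
        = ∫⁻ x, liminf (fun m ↦ Gm m x) atTop ∂D.vol := lintegral_congr_ae (hptw.mono fun x hx ↦ hx.liminf_eq.symm)
      _ ≤ _ := lintegral_liminf_le' hGmeas
  have hGint : ∀ m, ∫⁻ x, Gm m x ∂D.vol = ENNReal.ofReal (∫ x, κ x * (∑ j, ‖g (ns m) j x‖ ^ 2) * Real.exp (-φ x) ∂D.vol) :=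
    fun m ↦ (ofReal_integral_eq_lintegral_ofReal (Iκ (ns m)) (ae_of_all _ fun x ↦ by
      have := hκ0 x; positivity)).symm
  have hlim2 : liminf (fun m ↦ ∫⁻ x, Gm m x ∂D.vol) atTop ≤ ENNReal.ofReal (2 * ‖W.T† f‖ ^ 2) := by
    simp_rw [hGint]
    have hRns := (ENNReal.continuous_ofReal.tendsto _).comp (LR.comp hns.tendsto_atTop)
    rw [← hRns.liminf_eq]
    exact liminf_le_liminf (Eventually.of_forall fun m ↦ ENNReal.ofReal_le_ofReal (hest (ns m)))
  -- (5) conclusion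
  have hmeas : AEStronglyMeasurable (fun x ↦ κ x * (∑ j, ‖fF j x‖ ^ 2) * Real.exp (-φ x)) D.vol := by
    refine ((hκ.aestronglyMeasurable.mul (Finset.aestronglyMeasurable_fun_sum _ fun j _ ↦ ?_)).mul cE.aestronglyMeasurable)
    exact (continuous_pow 2).comp_aestronglyMeasurable (aestronglyMeasurable_of_memLp_volW W.continuous₂ (Lp.memLp ((f : W.H2) j))).norm
  have hfin := hFatou.trans hlim2
  have hnn : ∀ x, 0 ≤ κ x * (∑ j, ‖fF j x‖ ^ 2) * Real.exp (-φ x) := fun x ↦ by have := hκ0 x; positivity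
  refine ⟨⟨hmeas, ?_⟩, ?_⟩
  · rw [hasFiniteIntegral_iff_enorm]
    refine lt_of_le_of_lt (le_of_eq (lintegral_congr fun x ↦ ?_)) (hfin.trans_lt ENNReal.ofReal_lt_top)
    rw [Real.enorm_eq_ofReal (hnn x)]
  rw [integral_eq_lintegral_of_nonneg_ae (ae_of_all _ hnn) hmeas]
  have := ENNReal.toReal_mono ENNReal.ofReal_ne_top hfin
  rwa [ENNReal.toReal_ofReal (by positivity)] at this

end Closure

end Weights





end RiemannDomain

end Literature.Analysis.Complex
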